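import Mathlib

/-!
# `Balaban1983to89.B9` — T. Balaban, *Propagators for lattice gauge theories in a background field*,
Commun. Math. Phys. **99**, 389–434 (1985).  (INDEX: B9; refs: [1] = HUTMP B134 UNPUBLISHED (motivation
only, pp. 389, 417 — never cited here, GAPS G-B9-00), [2] = B4, [3] = B5, [4] = B6, [5] = B7.)
PDF held: `paper:balaban1985-cmp99-background-propagators` (journal page = PDF page + 388).

CITATION HEADER (lean-in-tree rule 2026-08-18). This module is a TYPED SKELETON (statement level) of the published paper
T. Bałaban, "Propagators for lattice gauge theories in a background field", *Comm. Math. Phys.* **99**, 389–434 (1985) [Balaban1985BackgroundPropagators] (cell paper B9).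
WHAT IS REPRODUCED: the main theorems/propositions as `def … : Prop` carrying the VERBATIM printed statement in the docstring
(journal page + equation numbers), over abstract carrier structures whose Prop-valued fields name the printed hypotheses; plus a few
kernel-checked pieces of elementary arithmetic re-deriving printed constants (the audit's "second engine").  NOTHING of the series is
asserted: the series' end-statement (ultraviolet stability of 4-d lattice gauge theories, [Balaban1987RG1] Thm 2 ff.) is a CLAIM UNDER
ADJUDICATION by the audit cell `pub-balaban`; every `…Printed` Prop here is consumed downstream only as a hypothesis `(h : …Printed …)`.
The cell's line-by-line census of this paper (objections located to page/equation, certifications) is the cell's GAPS.md (ids quoted in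
the docstrings: C-… certified, G-… objection/flag, D-… divergence row of the cell's DIVERGENCE.md).  Why local carrier structures and not
the shared `Setup` vocabulary (`…Balaban1983to89.Setup`): this paper's statements quantify over operator KERNELS and norm functionals
(random-walk expansions, Hölder norms, weighted sup norms, quadratic forms) that `Setup` deliberately does not model; the carriers only
NAME those functionals as fields, so no `Setup` definition is restated here and nothing is defined twice.  Staged byte-identically in the
cell package `run/shared/lean/pub/pub-balaban/lean/BalabanYm4/Literature/MathematicalPhysics/QuantumFieldTheory/Balaban1983to89/B9.lean`
(legacy copy `BalabanYm4/B9.lean` there, namespace `BalabanYm4.B9`, same declarations).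

Unit `b2b-balaban-r1` (reader group A).  STATEMENT LEVEL ONLY.  Typed: the regularity conditions
(3.35)–(3.38) p. 396; Theorem 3.1 (pp. 397–398: (3.42), (3.46), (3.47); the Hölder entries (3.43)–(3.45)
with their (β, ε)-dependent constants), Theorem 3.2 (3.48), Theorem 3.3, Theorem 3.4 (analytic extension),
Corollary 3.5 (U = 1, = the B6 import), Theorem 3.11 (positivity), Theorems 3.12/3.13 (Sect. D operators —
WITHOUT the covariant-Laplacian entry, interface warning G-B9-11), Theorem 3.14 (localisation of
differences, factor (3.154)), Theorem 3.15 ((3.187), the fluctuation covariance C^{(k)}(Λ)).  The random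
walk expansions Thms 3.7/3.9/3.10 are typed as ONE convergence predicate each (their printed content is
"expansion exists, converges in all the norms, terms localised with bound (3.94)/(3.99)/(3.108)").
KERNEL-CHECKED: census C-B9-2 (the factorial bound used on p. 411).  Companion prose:
`HOME/b2b-balaban-r1/B9.md`; census rows C-B9-*, G-B9-*, D-B9-1 in `HOME/GAPS.md`.

NORM DIVERGENCE (D-r1.1, verbatim p. 390): "|X| of a N × N matrix means the Hilbert–Schmidt norm, i.e.
|X|² = tr X*X" (normalised trace) — B7/B8 use the operator norm.  SYMBOL REUSE (D-r1.2): the Sect. A–C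
operator G = (Δ_a)^{−1} is renamed G₀ at (3.130); Sect. D's G = (Δ_π + DRD* + Q*aQ)^{−1}; δ₀, B₀ are
re-defined on pp. 423–424 as common best constants.  Below: `KernelFamily` instances are distinguished by
name by the USER of this file (G′, G_A, G_D, G₁, 𝔊, …); this file never identifies them.

REVISION v4 (unit `b2b-balaban-b09` gen 2, 2026-08-18; cell census G-ref1-7 = referee finding R9.8/R15.4, "one
symbol, one meaning"): the carrier `Geometry` now has TWO support predicates for arguments (`suppIn` = supp λ ⊂
Δ(y′), `suppInT` = supp λ ⊂ Δ̃(y′)) and TWO for cut-offs (`cutIn` = supp h ⊂ Δ(y), `cutInT` = ζ ∈ C₀^∞(Δ̃(y)))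
with the inclusions Δ ⊂ Δ̃ as fields, and `Ineq343_345` ((3.43)–(3.45)) and `Ineq3133` ((3.133)) are re-typed
with the printed support sets (renders of pp. 397, 398, 422 re-read); all other blocks print the small cubes
and keep `suppIn`/`cutIn`.  The v3 shapes follow from the v4 ones (`ineq343_345_restrict`, `ineq3133_restrict`),
so every consumer of these blocks AS HYPOTHESES is unaffected; the edge module `…B9FromB6` is revised with it
(its dictionary gains the two Δ̃-fields and one newly located residual: [4] (2.67) prints supp ζ ⊂ B^j(y) for G′
where (3.43) has ζ ∈ C₀^∞(Δ̃(y))).  One print slip recorded: (3.45) p. 398 reads "supp λ ⊂ Δ̃(y)", typed Δ̃(y′)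
(cell DIVERGENCE D-b09.8).
-/

namespace Literature.MathematicalPhysics.QuantumFieldTheory.Balaban1983to89.B9

/-! ## Multiscale geometry and the regularity conditions (Sect. A) -/

/-- Abstract multiscale geometry of B6 (2.1)–(2.4) / B9 Sect. A for fixed d, L: the set 𝔅 = ⋃_j Λ_j of
coarse sites with their scale index (`scale y = j` for y ∈ Λ_j), the multiscale distance d(y, y′) of B6
(2.46) (`dist`), the lattice spacing η = L^{−k}, the big-cube size parameter M, and the localisation of fine
points / functions: `Loc` = arguments λ (or J) with TWO support predicates (revision v4, cell census G-ref1-7 —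
one symbol, one meaning; p. 397: *"the families of cubes Δ(y), Δ̃(y). Here y, y′ ∈ 𝔅 = ⋃_{j=0}^k Λ_j. Let us
recall that if y ∈ Λ_j, then Δ(y) = B^j(y), and Δ̃(y) is a cube of the size 2L^jη on the lattice T_η with center
at the point y"*): `suppIn λ y′` = supp λ ⊂ Δ(y′) (printed in (3.42), (3.43), (3.46), (3.94), (3.108), (3.131))
and `suppInT λ y′` = supp λ ⊂ Δ̃(y′) (printed in (3.44), (3.45)); `supNorm` = |λ|, `l2Norm` = ‖λ‖, `wNorm γ λ` =
|λ|_{(γ)} of (3.40)–(3.41), `holder ε λ` = ‖λ‖^{ξ′}_ε; cut-offs ζ, h (`Cut`) with likewise TWO predicates: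
`cutIn h y` = supp h ⊂ Δ(y) (printed in (3.46)) and `cutInT ζ y` = ζ ∈ C₀^∞(Δ̃(y)) (printed in (3.43), (3.45),
(3.133)); the set inclusions Δ(y) ⊂ Δ̃(y) are the fields `suppInT_of_suppIn`, `cutInT_of_cutIn` (every
instance must prove them); `cutH β ζ` = ‖ζ‖^ξ_β + |ζ|, `cutSup h` = |h|. [cite: Balaban1985BackgroundPropagators, Sect. A (3.39)–(3.41) pp.396–397] -/
structure Geometry where
  Site : Type
  scale : Site → ℕ
  dist : Site → Site → ℝ
  k : ℕ
  eta : ℝ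
  L : ℝ
  M : ℝ
  Loc : Type
  suppIn : Loc → Site → Prop
  suppInT : Loc → Site → Prop
  supNorm : Loc → ℝ
  l2Norm : Loc → ℝ
  wNorm : ℝ → Loc → ℝ
  holder : ℝ → Loc → ℝ
  Cut : Type
  cutIn : Cut → Site → Prop
  cutInT : Cut → Site → Prop
  cutH : ℝ → Cut → ℝ
  cutSup : Cut → ℝ
  suppInT_of_suppIn : ∀ (lam : Loc) (y : Site), suppIn lam y → suppInT lam y
  cutInT_of_cutIn : ∀ (ζ : Cut) (y : Site), cutIn ζ y → cutInT ζ y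

/-- The scale length L^jη attached to a coarse site y ∈ Λ_j. [cite: Balaban1985BackgroundPropagators, (3.41) p.397] -/
noncomputable def Geometry.len (g : Geometry) (y : g.Site) : ℝ := g.L ^ g.scale y * g.eta

/-- Background configurations with the two regularity conditions of p. 396 and the complex class (3.37):
`Reg335 c α₀ U` = (3.35) with the geometric factor "O(1)" = c (verbatim: *"for an arbitrary cube □ of the
described above class, and for a configuration U there exists a gauge transformation u on □ such that
U^u = e^{iηA}, and if the index of □ is j, then |A| < O(1)Mα₀(L^jη)^{−1}, |∇^ηA| < O(1)Mα₀(L^jη)^{−2} on □,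
where O(1)M is a size of □"*, "the number O(1) … can be taken as equal to 12", p. 409); `Reg336 c α₀ U` =
(3.36): additionally |∂^{η*}∂^ηA| < O(1)Mα₀(L^jη)^{−3}; `Cplx337 α₁ U U′` = (3.37): U′ = e^{iηA′}, A′
𝔤ᶜ-valued, |A′| < α₁(L^jη)^{−1}, |∇^η_U A′| < α₁(L^jη)^{−2} on Ω_j; `Cplx338` = (3.38); `one` = U ≡ 1;
`mul U′ U` = the configuration U′U. [cite: Balaban1985BackgroundPropagators, (3.35)–(3.38) p.396] -/
structure Backgrounds where
  Cfg : Type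
  one : Cfg
  mul : Cfg → Cfg → Cfg
  Reg335 : ℝ → ℝ → Cfg → Prop
  Reg336 : ℝ → ℝ → Cfg → Prop
  Cplx337 : ℝ → Cfg → Cfg → Prop
  Cplx338 : ℝ → Cfg → Cfg → Prop

/-- A background-dependent OPERATOR seen through the quantities Theorem 3.1 bounds: for each
configuration U and argument λ, localised at coarse sites y (observation) — `e0 … e3` = the sup over
x ∈ Δ(y) of |(Gλ)(x)|, |(∇_U Gλ)(x)|, |(G∇*_U λ)(x)|, |(Δ_U Gλ)(x)| (the four entries of (3.42));
`h1 β ζ` = ‖ζ∇_U Gλ‖_β and ‖ζG∇*_U λ‖_β (3.43) (max of the two); `e4 = |(∇_U G∇*_U λ)(x)|` (3.44);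
`h2 β ζ` = ‖ζ∇_U G∇*_U λ‖_β (3.45); `l2 n h` = the six L² quantities of (3.46), n = 0…5, with cut-off h;
`glob n γ` = the four global quantities of (3.47) (n = 0…3: |Gλ|_{(2+γ)}, |∇_U Gλ|_{(1+γ)}, |G∇*_U λ|_{(1+γ)},
|Δ_U Gλ|_{(γ)} — 4th entry corrected from the print, G-B9-01). [cite: Balaban1985BackgroundPropagators, (3.42)–(3.47) pp.397–398] -/
structure KernelFamily (g : Geometry) (B : Backgrounds) where
  e : Fin 4 → B.Cfg → g.Loc → g.Site → ℝ
  h1 : B.Cfg → g.Loc → ℝ → g.Cut → ℝ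
  e4 : B.Cfg → g.Loc → g.Site → ℝ
  h2 : B.Cfg → g.Loc → ℝ → g.Cut → ℝ
  l2 : Fin 6 → B.Cfg → g.Loc → g.Cut → ℝ
  glob : Fin 4 → B.Cfg → g.Loc → ℝ → ℝ

variable {g : Geometry} {B : Backgrounds}

/-- The scale prefactors [(L^jη)², L^jη, L^jη, 1] of (3.42) and [(L^jη)², L^jη, L^jη, 1, 1, 1] of (3.46). [cite: Balaban1985BackgroundPropagators, (3.42) p.397] -/
noncomputable def pref4 (t : ℝ) : Fin 4 → ℝ := ![t ^ 2, t, t, 1]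
/-- see `pref4` [cite: Balaban1985BackgroundPropagators, (3.46) p.398] -/
noncomputable def pref6 (t : ℝ) : Fin 6 → ℝ := ![t ^ 2, t, t, 1, 1, 1]

/-- The inequalities (3.42), (3.46), (3.47) of Theorem 3.1 for ONE configuration U with constants
(B₀, δ₀) — the β- and ε-free part. [cite: Balaban1985BackgroundPropagators, (3.42) + (3.46) + (3.47) pp.397–398] -/
def Ineq342_346_347 (K : KernelFamily g B) (B₀ δ₀ : ℝ) (U : B.Cfg) : Prop :=
  (∀ (n : Fin 4) (lam : g.Loc) (y y' : g.Site), g.suppIn lam y' →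
      K.e n U lam y ≤ B₀ * pref4 (g.len y) n * Real.exp (-(δ₀ * g.dist y y')) * g.supNorm lam) ∧
  (∀ (n : Fin 6) (lam : g.Loc) (h : g.Cut) (y y' : g.Site), g.cutIn h y → g.suppIn lam y' →
      K.l2 n U lam h ≤ B₀ * pref6 (g.len y) n * g.cutSup h * Real.exp (-(δ₀ * g.dist y y')) * g.l2Norm lam) ∧
  (∀ (n : Fin 4) (lam : g.Loc) (γ : ℝ), -4 ≤ γ → γ ≤ 4 → K.glob n U lam γ ≤ B₀ * g.wNorm γ lam)

/-- The Hölder inequalities (3.43)–(3.45) for one U: constants B₀(β₀), B′₀(ε), B′₀(ε, β₀) depend on the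
indicated parameters ("→ ∞ if β → 1 / ε → 0"), typed as functions `Bβ`, `Bε`, `Bεβ`.  SUPPORT CONDITIONS
typed verbatim (revision v4, G-ref1-7; p. 398 [PDF 10]): (3.43) *"for 0 ≤ β ≤ β₀ < 1, ζ ∈ C₀^∞(Δ̃(y)), y ∈ Λ_j,
supp λ ⊂ Δ(y′)"* (`cutInT ζ y`, `suppIn λ y′`); (3.44) *"for 0 < ε ≤ 1, x ∈ Δ(y), supp λ ⊂ Δ̃(y′), y′ ∈ Λ_{j′},
ξ′ = L^{−j′}"* (`suppInT λ y′`); (3.45) *"for 0 < ε ≤ 1, 0 ≤ β ≤ β₀ < 1, ζ ∈ C₀^∞(Δ̃(y)), y ∈ Λ_j, ξ = L^{−j},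
supp λ ⊂ Δ̃(y) [sic], y′ ∈ Λ_{j′}, ξ′ = L^{−j′}"* (`cutInT ζ y`, `suppInT λ y′` — the printed "Δ̃(y)" in (3.45) is
read Δ̃(y′): y′ enters the display only through ξ′ and e^{−δ₀d(y,y′)}, and the source inequality B6 (2.139)
p. 247 prints "supp J ⊂ Δ̃(y′)"; cell DIVERGENCE D-b09.8).  `ineq343_345_restrict` recovers the block of
revision v3 (all supports in the small cubes Δ). [cite: Balaban1985BackgroundPropagators, (3.43)–(3.45) p.398] -/
def Ineq343_345 (K : KernelFamily g B) (Bβ : ℝ → ℝ) (Bε : ℝ → ℝ) (Bεβ : ℝ → ℝ → ℝ) (δ₀ : ℝ)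
    (U : B.Cfg) : Prop :=
  (∀ (β : ℝ) (lam : g.Loc) (ζ : g.Cut) (y y' : g.Site), 0 ≤ β → β < 1 → g.cutInT ζ y → g.suppIn lam y' →
      K.h1 U lam β ζ ≤ Bβ β * (g.len y) ^ (1 - β) * g.cutH β ζ * Real.exp (-(δ₀ * g.dist y y')) *
        g.supNorm lam) ∧
  (∀ (ε : ℝ) (lam : g.Loc) (y y' : g.Site), 0 < ε → ε ≤ 1 → g.suppInT lam y' →
      K.e4 U lam y ≤ Bε ε * Real.exp (-(δ₀ * g.dist y y')) * (g.holder ε lam + g.supNorm lam)) ∧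
  (∀ (ε β : ℝ) (lam : g.Loc) (ζ : g.Cut) (y y' : g.Site), 0 < ε → ε ≤ 1 → 0 ≤ β → β < 1 →
      g.cutInT ζ y → g.suppInT lam y' →
      K.h2 U lam β ζ ≤ Bεβ ε β * (g.len y) ^ (-β) * g.cutH β ζ * Real.exp (-(δ₀ * g.dist y y')) *
        (g.holder (β + ε) lam + g.supNorm lam))

/-- Revision v4 ⟹ revision v3 (bookkeeping of the re-typing, G-ref1-7): the verbatim Hölder block implies the
block with ALL supports in the small cubes Δ(y), Δ(y′) (the shape of revision v3 read with `suppIn` = Δ,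
`cutIn` = Δ) through the carried inclusions Δ ⊂ Δ̃ — the re-typing strengthened (3.44), (3.45) and the ζ-range
of (3.43), (3.45) up to the print and weakened nothing. [cite: Balaban1985BackgroundPropagators, (3.43)–(3.45) p.398] -/
theorem ineq343_345_restrict (K : KernelFamily g B) (Bβ Bε : ℝ → ℝ) (Bεβ : ℝ → ℝ → ℝ) (δ₀ : ℝ)
    (U : B.Cfg) (h : Ineq343_345 K Bβ Bε Bεβ δ₀ U) :
    (∀ (β : ℝ) (lam : g.Loc) (ζ : g.Cut) (y y' : g.Site), 0 ≤ β → β < 1 → g.cutIn ζ y → g.suppIn lam y' →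
        K.h1 U lam β ζ ≤ Bβ β * (g.len y) ^ (1 - β) * g.cutH β ζ * Real.exp (-(δ₀ * g.dist y y')) *
          g.supNorm lam) ∧
    (∀ (ε : ℝ) (lam : g.Loc) (y y' : g.Site), 0 < ε → ε ≤ 1 → g.suppIn lam y' →
        K.e4 U lam y ≤ Bε ε * Real.exp (-(δ₀ * g.dist y y')) * (g.holder ε lam + g.supNorm lam)) ∧
    (∀ (ε β : ℝ) (lam : g.Loc) (ζ : g.Cut) (y y' : g.Site), 0 < ε → ε ≤ 1 → 0 ≤ β → β < 1 →
        g.cutIn ζ y → g.suppIn lam y' →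
        K.h2 U lam β ζ ≤ Bεβ ε β * (g.len y) ^ (-β) * g.cutH β ζ * Real.exp (-(δ₀ * g.dist y y')) *
          (g.holder (β + ε) lam + g.supNorm lam)) :=
  ⟨fun β lam ζ y y' h0 h1 hζ hs => h.1 β lam ζ y y' h0 h1 (g.cutInT_of_cutIn ζ y hζ) hs,
    fun ε lam y y' h0 h1 hs => h.2.1 ε lam y y' h0 h1 (g.suppInT_of_suppIn lam y' hs),
    fun ε β lam ζ y y' h0 h1 h2 h3 hζ hs =>
      h.2.2 ε β lam ζ y y' h0 h1 h2 h3 (g.cutInT_of_cutIn ζ y hζ) (g.suppInT_of_suppIn lam y' hs)⟩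

/-- **Theorem 3.1** (pp. 397–398 [PDF 9–10], verbatim frame): *"There exist positive constants M₁, δ₀, a₀,
B₀ dependent on d and L only, a constant B₀(β) dependent on d, L and β, 0 ≤ β < 1 (B₀(β) → ∞ if β → 1),
such that for M ≥ M₁ and for an arbitrary configuration U satisfying the regularity condition (3.35) with
Mα₀ ≤ a₀, the operator G′(U) (a = 1) satisfies the inequalities [(3.42)–(3.47), see `Ineq342_346_347`,
`Ineq343_345`; full display in B9.md §1] … for γ in a fixed compact subset of real numbers, e.g. for
γ ∈ [−4, 4]. All these inequalities are invariant with respect to gauge transformations of U."* (closing sentence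
re-set word for word in v4.1, census C-pv13-7 / G-pv10-1 (c)).  Family index `I` = (torus, k, {Ω_j}, M) for fixed d, L (p. 399: constants independent
of {Ω_j}); `c35` = the O(1) of (3.35).  Quantifier order: M₁, δ₀, a₀, B₀, B₀(·), B′₀(·), B′₀(·,·) BEFORE i, U. [cite: Balaban1985BackgroundPropagators, Thm 3.1 (3.42)–(3.47) pp.397–398] -/
def Thm31Printed {I : Type} (c35 : ℝ) (geo : I → Geometry) (bg : I → Backgrounds)
    (Gp : ∀ i, KernelFamily (geo i) (bg i)) : Prop :=
  ∃ M₁ δ₀ a₀ B₀ : ℝ, ∃ Bβ Bε : ℝ → ℝ, ∃ Bεβ : ℝ → ℝ → ℝ,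
    0 < M₁ ∧ 0 < δ₀ ∧ 0 < a₀ ∧ 0 < B₀ ∧
    ∀ i : I, M₁ ≤ (geo i).M → ∀ α₀ : ℝ, 0 < α₀ → (geo i).M * α₀ ≤ a₀ →
      ∀ U : (bg i).Cfg, (bg i).Reg335 c35 α₀ U →
        Ineq342_346_347 (Gp i) B₀ δ₀ U ∧ Ineq343_345 (Gp i) Bβ Bε Bεβ δ₀ U

/-- A two-point KERNEL on 𝔅 (for (Q′G′²Q′*)^{−1} (3.48), (QGQ*)^{−1}, H, and C^{(k)}(Λ) (3.187)). [cite: Balaban1985BackgroundPropagators, (3.48) + (3.187) pp.398 + 432] -/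
structure SiteKernel (g : Geometry) (B : Backgrounds) where
  ker : B.Cfg → g.Site → g.Site → ℝ

/-- **Theorem 3.2** (p. 398 [PDF 10], verbatim): *"Under the assumptions of Theorem 3.1, and with the same
constants, the following inequality holds: |(Q′(U)G′²(U)Q′*(U))^{−1}(y, y′)| ≤ B₀(L^jη)^{−4}(L^{j′}η)^{−d}
e^{−δ₀d(y,y′)}, y, y′ ∈ 𝔅 (y ∈ Λ_j, y′ ∈ Λ_{j′}) (3.48)."*  Typed jointly with Thm 3.1's constants: the SAME
(M₁, δ₀, a₀, B₀) serve both (hence one existential block). [cite: Balaban1985BackgroundPropagators, Thm 3.2 (3.48) p.398] -/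
def Thm31and32Printed {I : Type} (d : ℕ) (c35 : ℝ) (geo : I → Geometry) (bg : I → Backgrounds)
    (Gp : ∀ i, KernelFamily (geo i) (bg i)) (Cinv : ∀ i, SiteKernel (geo i) (bg i)) : Prop :=
  ∃ M₁ δ₀ a₀ B₀ : ℝ, ∃ Bβ Bε : ℝ → ℝ, ∃ Bεβ : ℝ → ℝ → ℝ,
    0 < M₁ ∧ 0 < δ₀ ∧ 0 < a₀ ∧ 0 < B₀ ∧
    ∀ i : I, M₁ ≤ (geo i).M → ∀ α₀ : ℝ, 0 < α₀ → (geo i).M * α₀ ≤ a₀ →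
      ∀ U : (bg i).Cfg, (bg i).Reg335 c35 α₀ U →
        Ineq342_346_347 (Gp i) B₀ δ₀ U ∧ Ineq343_345 (Gp i) Bβ Bε Bεβ δ₀ U ∧
        ∀ y y' : (geo i).Site, |(Cinv i).ker U y y'| ≤
          B₀ * ((geo i).len y) ^ (-(4 : ℝ)) * ((geo i).len y') ^ (-(d : ℝ)) *
            Real.exp (-(δ₀ * (geo i).dist y y'))

/-- **Theorem 3.3** (p. 399 [PDF 11], verbatim): *"Under the assumptions of Theorem 3.1, and with the
constants described there, the operator G(U) (a = 1) satisfies the inequalities (3.42)–(3.47), with G′(U)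
replaced by G(U) and λ replaced by a function J defined at bonds of the lattice T_η, or Ω₀, and with values
in 𝔤."*  Typed: the same predicate for a second kernel family `GA` (= Sect. A–C operator G = Δ_a^{−1},
renamed G₀ at (3.130); NOT Sect. D's G — D-r1.2) with the same constants as G′. [cite: Balaban1985BackgroundPropagators, Thm 3.3 p.399] -/
def Thm33Printed {I : Type} (c35 : ℝ) (geo : I → Geometry) (bg : I → Backgrounds)
    (Gp GA : ∀ i, KernelFamily (geo i) (bg i)) : Prop :=
  ∃ M₁ δ₀ a₀ B₀ : ℝ, ∃ Bβ Bε : ℝ → ℝ, ∃ Bεβ : ℝ → ℝ → ℝ,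
    0 < M₁ ∧ 0 < δ₀ ∧ 0 < a₀ ∧ 0 < B₀ ∧
    ∀ i : I, M₁ ≤ (geo i).M → ∀ α₀ : ℝ, 0 < α₀ → (geo i).M * α₀ ≤ a₀ →
      ∀ U : (bg i).Cfg, (bg i).Reg335 c35 α₀ U →
        (Ineq342_346_347 (Gp i) B₀ δ₀ U ∧ Ineq343_345 (Gp i) Bβ Bε Bεβ δ₀ U) ∧
        (Ineq342_346_347 (GA i) B₀ δ₀ U ∧ Ineq343_345 (GA i) Bβ Bε Bεβ δ₀ U)

/-- **Theorem 3.4** (p. 400 [PDF 12], verbatim): *"There exists a positive constant a₁ such that the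
operators G′(U), (Q′(U)G′²(U)Q′*(U))^{−1}, R(U), G(U) extend to configurations U′U for α₁ ≤ a₁ as analytic
functions of A. The extended operators satisfy all the inequalities of Theorems 3.1–3.3 correspondingly."*
`IsAnalyticExt K U α₁` = "K(U′U) is analytic in A′ on the domain (3.37) with radius α₁" (abstract);
the inequality half is typed for the two kernel families on the complex class `Cplx337`.  Rests on B7
Props 6–7 for complex backgrounds (GAPS G-B7-05) via (3.78)–(3.81). [cite: Balaban1985BackgroundPropagators, Thm 3.4 p.400] -/
def Thm34Printed {I : Type} (c35 : ℝ) (geo : I → Geometry) (bg : I → Backgrounds)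
    (Gp GA : ∀ i, KernelFamily (geo i) (bg i))
    (IsAnalyticExt : ∀ i, KernelFamily (geo i) (bg i) → (bg i).Cfg → ℝ → Prop) : Prop :=
  ∃ a₁ M₁ δ₀ a₀ B₀ : ℝ, ∃ Bβ Bε : ℝ → ℝ, ∃ Bεβ : ℝ → ℝ → ℝ,
    0 < a₁ ∧ 0 < M₁ ∧ 0 < δ₀ ∧ 0 < a₀ ∧ 0 < B₀ ∧
    ∀ i : I, M₁ ≤ (geo i).M → ∀ α₀ α₁ : ℝ, 0 < α₀ → (geo i).M * α₀ ≤ a₀ → 0 < α₁ → α₁ ≤ a₁ →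
      ∀ U : (bg i).Cfg, (bg i).Reg335 c35 α₀ U →
        IsAnalyticExt i (Gp i) U α₁ ∧ IsAnalyticExt i (GA i) U α₁ ∧
        ∀ U' : (bg i).Cfg, (bg i).Cplx337 α₁ U U' →
          Ineq342_346_347 (Gp i) B₀ δ₀ ((bg i).mul U' U) ∧ Ineq343_345 (Gp i) Bβ Bε Bεβ δ₀ ((bg i).mul U' U) ∧
          Ineq342_346_347 (GA i) B₀ δ₀ ((bg i).mul U' U) ∧ Ineq343_345 (GA i) Bβ Bε Bεβ δ₀ ((bg i).mul U' U)

/-- **Corollary 3.5** (p. 407 [PDF 19], verbatim): *"If a configuration U′ is in the domain (3.37) with U = 1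
and α₁ ≤ a₁, then Theorems 3.1–3.3 hold for the operators G′(U′), (Q′(U′)G′²(U′)Q′*(U′))^{−1}, G(U′)
correspondingly."*  Basis (p. 407): "for U = 1 these theorems are proved in [4]" = B6 Props 2.2, 2.3,
2.6–2.7, Cor. 2.8, (2.137)–(2.140) — the INDUCTION BASE of the paper; GAPS G-B9-03 = the entry-by-entry
match of (3.42)–(3.47)|_{U=1} with B6, still owed.  This def is the SHAPE of the B6 import at U = 1. [cite: Balaban1985BackgroundPropagators, Cor. 3.5 p.407] -/
def Cor35_U1_Shape {I : Type} (geo : I → Geometry) (bg : I → Backgrounds)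
    (Gp GA : ∀ i, KernelFamily (geo i) (bg i)) : Prop :=
  ∃ M₁ δ₀ B₀ : ℝ, ∃ Bβ Bε : ℝ → ℝ, ∃ Bεβ : ℝ → ℝ → ℝ, 0 < M₁ ∧ 0 < δ₀ ∧ 0 < B₀ ∧
    ∀ i : I, M₁ ≤ (geo i).M →
      (Ineq342_346_347 (Gp i) B₀ δ₀ (bg i).one ∧ Ineq343_345 (Gp i) Bβ Bε Bεβ δ₀ (bg i).one) ∧
      (Ineq342_346_347 (GA i) B₀ δ₀ (bg i).one ∧ Ineq343_345 (GA i) Bβ Bε Bεβ δ₀ (bg i).one)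

/-- **Theorems 3.7 / 3.9 / 3.10** (pp. 409, 413, 415–416; verbatim in B9.md §3): generalized random walk
expansions G′ = Σ_ω …(3.90), (Q′G′²Q′*)^{−1} = Σ_ω R′₀(X₀)R′_{α₁}(X₁)⋯ (3.98), G = Σ_ω R₀(X₀)R_{α₁}(X₁)⋯
(3.107), "convergent in all norms appearing in the inequalities (3.42)–(3.47)", each term depending on U
restricted to X̃⁵₀ ∪ … ∪ X̃⁵_n with the bound O(1)(scale factor)O(M^{−1/2})^{|ω|}M^{−½|ω|}e^{−½δ₀d(ω,y,y′)}
((3.94), (3.99), (3.108)).  Typed as ONE abstract predicate per operator: `HasRWExp K U δ₀` supplied by the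
user of this file (the printed content beyond Thms 3.1–3.3 is the localisation/analyticity structure used by
B10–B12's cluster expansions).  GAPS G-B9-07: proofs by reference to B6 + sketch. [cite: Balaban1985BackgroundPropagators, Thms 3.7 + 3.9 + 3.10 (3.90) pp.409–416] -/
def Thm37_39_310Printed {I : Type} (c35 : ℝ) (geo : I → Geometry) (bg : I → Backgrounds)
    (Gp GA : ∀ i, KernelFamily (geo i) (bg i))
    (HasRWExp : ∀ i, KernelFamily (geo i) (bg i) → (bg i).Cfg → ℝ → Prop)
    (HasRWExpInv : ∀ i, (bg i).Cfg → ℝ → Prop) : Prop :=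
  ∃ M₂ δ₀ a₀ : ℝ, 0 < M₂ ∧ 0 < δ₀ ∧ 0 < a₀ ∧
    ∀ i : I, M₂ ≤ (geo i).M → ∀ α₀ : ℝ, 0 < α₀ → (geo i).M * α₀ ≤ a₀ →
      ∀ U : (bg i).Cfg, (bg i).Reg335 c35 α₀ U →
        HasRWExp i (Gp i) U δ₀ ∧ HasRWExpInv i U δ₀ ∧ HasRWExp i (GA i) U δ₀

/-- C-B9-2, kernel-checked (p. 411 [PDF 23], the bound used to trade the exponential for powers of M):
e^{−s} ≤ 3!·s^{−3} for s > 0, and with s = ¼δ₀M: 3!(¼δ₀M)^{−3} = 384(δ₀M)^{−3} ≤ 512(δ₀M)^{−3} = (8/(δ₀M))³. [folklore] -/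
theorem exp_neg_le_six_div_cube (s : ℝ) (hs : 0 < s) : Real.exp (-s) ≤ 6 / s ^ 3 := by
  have h := Real.pow_div_factorial_le_exp (x := s) (hx := le_of_lt hs) 3
  have h3 : (Nat.factorial 3 : ℝ) = 6 := by norm_num [Nat.factorial]
  rw [h3] at h
  rw [Real.exp_neg, inv_le_comm₀ (Real.exp_pos s) (by positivity), inv_div]
  calc s ^ 3 / 6 ≤ Real.exp s := h

/-- C-B9-2 (p. 411), kernel-checked: e^{−δ₀M/4} ≤ (8/(δ₀M))³ — the elementary bound behind the text's
"M⁴e^{−(1/4)δ₀M} ≤ M₁" bookkeeping. [folklore] -/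
theorem p411_constant (δ₀ M : ℝ) (hδ : 0 < δ₀) (hM : 0 < M) :
    Real.exp (-(δ₀ * M / 4)) ≤ (8 / (δ₀ * M)) ^ 3 := by
  have hs : 0 < δ₀ * M / 4 := by positivity
  have h1 := exp_neg_le_six_div_cube _ hs
  have h2 : 6 / (δ₀ * M / 4) ^ 3 ≤ (8 / (δ₀ * M)) ^ 3 := by
    have hpos : 0 < δ₀ * M := by positivity
    rw [div_pow, div_pow, div_le_div_iff₀ (by positivity) (by positivity)]
    nlinarith [pow_pos hpos 3]
  exact h1.trans h2

/-- **Theorem 3.11** (p. 416 [PDF 28], verbatim): *"Under the assumptions of the Theorems 3.1–3.10 (i.e. for M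
sufficiently large and α₀ sufficiently small) the operators Δ′_a, G′, (Q′G′²Q′*)^{−1}, Δ_a, G are positive
definite."*  `PosDef i n U` = positivity of the n-th of the five operators.  GAPS G-B9-06: the proof uses
L²-smallness of R where only kernel/sup smallness is displayed (Schur-test paragraph missing). [cite: Balaban1985BackgroundPropagators, Thm 3.11 pp.416–417] -/
def Thm311Printed {I : Type} (c35 : ℝ) (geo : I → Geometry) (bg : I → Backgrounds)
    (PosDef : ∀ i, Fin 5 → (bg i).Cfg → Prop) : Prop :=
  ∃ M₃ a₀ : ℝ, 0 < M₃ ∧ 0 < a₀ ∧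
    ∀ i : I, M₃ ≤ (geo i).M → ∀ α₀ : ℝ, 0 < α₀ → (geo i).M * α₀ ≤ a₀ →
      ∀ U : (bg i).Cfg, (bg i).Reg335 c35 α₀ U → ∀ n : Fin 5, PosDef i n U

/-- Theorem 3.3's inequalities WITHOUT the covariant-Laplacian entry (n = 3 of (3.42)): the form in which
Thms 3.12/3.13 assert them for the Sect. D propagators. [cite: Balaban1985BackgroundPropagators, Thms 3.12–3.13 pp.423–426] -/
def Ineq342_346_347_noLap (K : KernelFamily g B) (B₀ δ₀ : ℝ) (U : B.Cfg) : Prop :=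
  (∀ (n : Fin 4) (lam : g.Loc) (y y' : g.Site), n ≠ 3 → g.suppIn lam y' →
      K.e n U lam y ≤ B₀ * pref4 (g.len y) n * Real.exp (-(δ₀ * g.dist y y')) * g.supNorm lam) ∧
  (∀ (n : Fin 6) (lam : g.Loc) (h : g.Cut) (y y' : g.Site), g.cutIn h y → g.suppIn lam y' →
      K.l2 n U lam h ≤ B₀ * pref6 (g.len y) n * g.cutSup h * Real.exp (-(δ₀ * g.dist y y')) * g.l2Norm lam) ∧
  (∀ (n : Fin 4) (lam : g.Loc) (γ : ℝ), n ≠ 3 → -4 ≤ γ → γ ≤ 4 → K.glob n U lam γ ≤ B₀ * g.wNorm γ lam)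

/-- **Theorem 3.12** (p. 423 [PDF 35], verbatim): *"If an external gauge field configuration U satisfies both
regularity conditions (3.35), (3.36) for α₀ sufficiently small, then Theorems 3.3, 3.10, 3.11 hold for the
propagators G, G₁, with one exception and the inequality (1.133)[sic: (3.133)] together with Theorem 3.10
hold for the operators H, H₁.  The exception is the inequality in (3.42) involving the covariant Laplace
operator.  It does not hold for G, G₁."*  and **Theorem 3.13** (p. 426 [PDF 38], verbatim): *"If an external
gauge field configuration U satisfies the regularity conditions (3.35), (3.36) for α₀ sufficiently small,
then Theorems 3.3, 3.10, 3.11 hold for the propagator 𝔊, with the exception of the inequality in (3.42)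
involving the covariant Laplace operator."*  Here G = (Δ_π + DRD* + Q*aQ)^{−1} (3.122) (Sect. D — NOT the
G of Thm 3.3), G₁ (3.128), 𝔊 = 𝔓G₁ (3.153); H = GQ*(QGQ*)^{−1} (3.126), H₁ (3.129) with the kernel bound
(3.133): |H(x, y)|, … ≤ B₀(L^jη)^{[0,−1,…]}e^{−δ₀d(y(x),y)}.  After these theorems δ₀, B₀ are RE-DEFINED as the
common best constants (pp. 423–424, D-r1.2).  Typed for the three kernel families and two H-kernels. [cite: Balaban1985BackgroundPropagators, Thms 3.12–3.13 (3.133) pp.423–426] -/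
def Thm312_313Printed {I : Type} (c35 : ℝ) (geo : I → Geometry) (bg : I → Backgrounds)
    (GD G₁ GG : ∀ i, KernelFamily (geo i) (bg i)) (H H₁ : ∀ i, SiteKernel (geo i) (bg i))
    (HBound : ∀ i, SiteKernel (geo i) (bg i) → ℝ → ℝ → (bg i).Cfg → Prop)
    (HasRWExp : ∀ i, KernelFamily (geo i) (bg i) → (bg i).Cfg → ℝ → Prop)
    (PosDefK : ∀ i, KernelFamily (geo i) (bg i) → (bg i).Cfg → Prop) : Prop :=
  ∃ M₄ δ₀ a₀ B₀ : ℝ, 0 < M₄ ∧ 0 < δ₀ ∧ 0 < a₀ ∧ 0 < B₀ ∧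
    ∀ i : I, M₄ ≤ (geo i).M → ∀ α₀ : ℝ, 0 < α₀ → (geo i).M * α₀ ≤ a₀ →
      ∀ U : (bg i).Cfg, (bg i).Reg335 c35 α₀ U → (bg i).Reg336 c35 α₀ U →
        (∀ K ∈ [GD i, G₁ i, GG i], Ineq342_346_347_noLap K B₀ δ₀ U ∧ HasRWExp i K U δ₀ ∧ PosDefK i K U) ∧
        HBound i (H i) B₀ δ₀ U ∧ HBound i (H₁ i) B₀ δ₀ U

/-- **Theorem 3.14** (pp. 426–427 [PDF 38–39], verbatim): *"If we take a pair of operators constructed for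
the two sequences {Ω_j}, {Ω′_j}, then their difference satisfies all the inequalities characteristic for
operators of the considered type, with the additional factor exp(−δ₀d(y, y′, Ω)),
d(y, y′, Ω) = inf_{y₁∈Ωᶜ∩T^{(k)}}(|y − y₁| + |y₁ − y′|) (3.154) on the right-hand sides."*  (Ω = Ω_k ∩ Ω′_k;
both sequences satisfy (2.1)–(2.4) of [4] with M, R large.)  Typed for the basic sup entries of a kernel
family: `Kdiff` = the difference operator seen through the same quantities, `dOmega` = (3.154).
GAPS G-B9-08: proof by reference to "the theorem of [2]" (B4 (1.11)–(1.12), itself G-B4-01) + sketch. [cite: Balaban1985BackgroundPropagators, Thm 3.14 (3.154) pp.426–427] -/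
def Thm314Printed {I : Type} (c35 : ℝ) (geo : I → Geometry) (bg : I → Backgrounds)
    (Kdiff : ∀ i, KernelFamily (geo i) (bg i)) (dOmega : ∀ i, (geo i).Site → (geo i).Site → ℝ) : Prop :=
  ∃ M₅ δ₀ a₀ B₀ : ℝ, 0 < M₅ ∧ 0 < δ₀ ∧ 0 < a₀ ∧ 0 < B₀ ∧
    ∀ i : I, M₅ ≤ (geo i).M → ∀ α₀ : ℝ, 0 < α₀ → (geo i).M * α₀ ≤ a₀ →
      ∀ U : (bg i).Cfg, (bg i).Reg335 c35 α₀ U →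
        ∀ (n : Fin 4) (lam : (geo i).Loc) (y y' : (geo i).Site), (geo i).suppIn lam y' →
          (Kdiff i).e n U lam y ≤ B₀ * pref4 ((geo i).len y) n * Real.exp (-(δ₀ * (geo i).dist y y')) *
            Real.exp (-(δ₀ * dOmega i y y')) * (geo i).supNorm lam

/-- **Theorem 3.15** (p. 432 [PDF 44], verbatim): *"For Mα₀ sufficiently small the propagator C^{(k)}(Λ) is
given by the formula (3.185), and satisfies the bound |C^{(k)}(Λ; y, y′)| ≤ B₀e^{−δ₀|y−y′|}, y, y′ ∈ Λ (3.187)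
with the constants B₀, δ₀ depending on d and L only.  This propagator has a convergent random walk expansion
of the type described previously. …"*  ((3.185): C^{(k)}(Λ) = (I + D̄μ)QG̃₂Q*(I + μ*D̄*); Λ ⊂ T₁^{(k)} a
union of big blocks; hypotheses (3.35)–(3.36).)  `unitDist` = |y − y′| on the unit lattice T₁^{(k)},
`inΛ` = membership in Λ (part of the instance).  GAPS G-B9-10 (OBJECTION): the G₂ − G₁ perturbation
estimate behind this theorem is not displayed (p. 432, after (3.186)); G-B9-09: the uniform lower bound γ₀
of C*Δ_kC for general U (p. 428) is asserted, not proved. [cite: Balaban1985BackgroundPropagators, Thm 3.15 (3.185)–(3.187) p.432] -/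
def Thm315Printed {I : Type} (c35 : ℝ) (geo : I → Geometry) (bg : I → Backgrounds)
    (Ck : ∀ i, SiteKernel (geo i) (bg i)) (inΛ : ∀ i, (geo i).Site → Prop)
    (unitDist : ∀ i, (geo i).Site → (geo i).Site → ℝ) : Prop :=
  ∃ δ₀ a₀ B₀ : ℝ, 0 < δ₀ ∧ 0 < a₀ ∧ 0 < B₀ ∧
    ∀ i : I, ∀ α₀ : ℝ, 0 < α₀ → (geo i).M * α₀ ≤ a₀ →
      ∀ U : (bg i).Cfg, (bg i).Reg335 c35 α₀ U → (bg i).Reg336 c35 α₀ U →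
        ∀ y y' : (geo i).Site, inΛ i y → inΛ i y' →
          |(Ck i).ker U y y'| ≤ B₀ * Real.exp (-(δ₀ * unitDist i y y'))

/-- Bookkeeping (kernel-checked): the global inequalities (3.47) with γ = −3 — the form B8 (1.59) cites as
"Theorem 3.3 of [4]" (GAPS G-B8-06) — are an instance of `Ineq342_346_347`. [folklore] -/
theorem glob_at_minus_three (K : KernelFamily g B) {B₀ δ₀ : ℝ} {U : B.Cfg}
    (h : Ineq342_346_347 K B₀ δ₀ U) (n : Fin 4) (lam : g.Loc) :
    K.glob n U lam (-3) ≤ B₀ * g.wNorm (-3) lam :=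
  h.2.2 n lam (-3) (by norm_num) (by norm_num)

/-! ## Paper sub-cell B09 (phase 2, unit `b2b-balaban-b09`, 2026-08-18)

Every numbered statement of the paper typed SEPARATELY and verbatim (Thm 3.2; Cor. 3.5 in full; Cor. 3.6;
Thm 3.7; Cor. 3.8; Thm 3.9; Thm 3.10; Thm 3.12; Thm 3.13; Thm 3.15 in full; the displayed inequalities
(3.49), (3.132), (3.133)); the paper's PRINTED INTERNAL IMPLICATIONS as kernel-checked theorems whose
by-reference steps are explicit named hypotheses (each such hypothesis is one located row of the cell's
GAPS.md: G-B9-12 …; certifications C-B9-7 …); the Sect. D operator algebra ((3.146) ⇒ (3.147), the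
𝔓-identities of p. 425, (3.150) ⇒ (3.153)) kernel-checked over an arbitrary ring from exactly the identities
the text names; and the elementary "M sufficiently large" arithmetic of Sects. B–C.  Nothing here asserts any
`…Printed` statement; the declarations above (unit r1) are untouched but for the support-predicate split of
revision v4 (G-ref1-7, module docstring) (B8.lean and Dag.lean name them). -/

/-! ### Sect. A — Theorem 3.2 alone; the kernel bounds (3.49) -/

/-- **Theorem 3.2** (p. 398 [PDF 10]) typed ALONE (verbatim): *"Under the assumptions of Theorem 3.1, and with
the same constants, the following inequality holds: |(Q′(U)G′²(U)Q′*(U))^{−1}(y, y′)| ≤ B₀(L^jη)^{−4}(L^{j′}η)^{−d}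
e^{−δ₀d(y,y′)}, y, y′ ∈ 𝔅 (y ∈ Λ_j, y′ ∈ Λ_{j′}) (3.48)."*  "With the same constants" (shared with Thm 3.1) is
what `Thm31and32Printed` keeps and this stand-alone form forgets (`thm31_and_thm32_of_joint`; the converse
re-coupling is not claimed — cell DIVERGENCE row D-b09.1). [cite: Balaban1985BackgroundPropagators, Thm 3.2 (3.48) p.398] -/
def Thm32Printed {I : Type} (d : ℕ) (c35 : ℝ) (geo : I → Geometry) (bg : I → Backgrounds)
    (Cinv : ∀ i, SiteKernel (geo i) (bg i)) : Prop :=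
  ∃ M₁ δ₀ a₀ B₀ : ℝ, 0 < M₁ ∧ 0 < δ₀ ∧ 0 < a₀ ∧ 0 < B₀ ∧
    ∀ i : I, M₁ ≤ (geo i).M → ∀ α₀ : ℝ, 0 < α₀ → (geo i).M * α₀ ≤ a₀ →
      ∀ U : (bg i).Cfg, (bg i).Reg335 c35 α₀ U →
        ∀ y y' : (geo i).Site, |(Cinv i).ker U y y'| ≤
          B₀ * ((geo i).len y) ^ (-(4 : ℝ)) * ((geo i).len y') ^ (-(d : ℝ)) *
            Real.exp (-(δ₀ * (geo i).dist y y'))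

/-- Bookkeeping (kernel-checked): the jointly typed Theorems 3.1 + 3.2 give each theorem separately. [folklore] -/
theorem thm31_and_thm32_of_joint {I : Type} (d : ℕ) (c35 : ℝ) (geo : I → Geometry) (bg : I → Backgrounds)
    (Gp : ∀ i, KernelFamily (geo i) (bg i)) (Cinv : ∀ i, SiteKernel (geo i) (bg i))
    (h : Thm31and32Printed d c35 geo bg Gp Cinv) :
    Thm31Printed c35 geo bg Gp ∧ Thm32Printed d c35 geo bg Cinv := by
  obtain ⟨M₁, δ₀, a₀, B₀, Bβ, Bε, Bεβ, hM, hδ, ha, hB, H⟩ := h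
  refine ⟨⟨M₁, δ₀, a₀, B₀, Bβ, Bε, Bεβ, hM, hδ, ha, hB, ?_⟩, ⟨M₁, δ₀, a₀, B₀, hM, hδ, ha, hB, ?_⟩⟩
  · intro i hMi α₀ hα hMa U hU
    exact ⟨(H i hMi α₀ hα hMa U hU).1, (H i hMi α₀ hα hMa U hU).2.1⟩
  · intro i hMi α₀ hα hMa U hU
    exact (H i hMi α₀ hα hMa U hU).2.2

/-- A FINE two-point kernel seen through the four entries of (3.49) (same shape at (3.68), (3.77), (3.101)):
for coarse sites y, y′ the sup over x ∈ Δ(y), x′ ∈ Δ(y′) of |P(x, x′)|, |(DP)_μ(x, x′)|, |(PD*)_ν(x, x′)|,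
|(DPD*)_{μν}(x, x′)| (n = 0 … 3). [cite: Balaban1985BackgroundPropagators, (3.49) p.399] -/
structure FineKernel (g : Geometry) (B : Backgrounds) where
  ker : Fin 4 → B.Cfg → g.Site → g.Site → ℝ

/-- The scale prefactors [1, (L^jη)^{−1}, (L^jη)^{−1}, (L^jη)^{−2}] of (3.49). [cite: Balaban1985BackgroundPropagators, (3.49) p.399] -/
noncomputable def pref4inv (t : ℝ) : Fin 4 → ℝ := ![1, t⁻¹, t⁻¹, t⁻¹ ^ 2]

/-- The inequalities **(3.49)** for P = I − R at one configuration U with constants (C, δ₀) (verbatim, p. 399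
[PDF 11]): *"[|P(x, x′)|, |(DP)_μ(x, x′)|, |(PD*)_ν(x, x′)|, |(DPD*)_{μν}(x, x′)|] ≤ O(1)[1, (L^jη)^{−1}, (L^jη)^{−1},
(L^jη)^{−2}](L^{j′}η)^{−d}e^{−(1/2)δ₀d(y,y′)} for x ∈ Δ(y), y ∈ Λ_j, x′ ∈ Δ(y′), y′ ∈ Λ_{j′}. (3.49)  We have also
the corresponding bounds for Hölder norms of the kernel (DPD*)_{μν}(x, x′).  Thus the operator Δ_a is well
defined."*  Printed derivation: *"These theorems [3.1, 3.2] imply all the properties of the operator R …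
using again Lemma 2.1"* (composition G′Q′*(Q′G′²Q′*)^{−1}Q′G′ + one B6-Lemma-2.1 summation, not displayed —
GAPS G-B9-12, asserted-routine). [cite: Balaban1985BackgroundPropagators, (3.49) p.399] -/
def Ineq349 (d : ℕ) (P : FineKernel g B) (C δ₀ : ℝ) (U : B.Cfg) : Prop :=
  ∀ (n : Fin 4) (y y' : g.Site),
    P.ker n U y y' ≤ C * pref4inv (g.len y) n * (g.len y') ^ (-(d : ℝ)) *
      Real.exp (-(δ₀ / 2 * g.dist y y'))

/-- The printed CLAIM (3.49) as a family statement: under the assumptions of Theorem 3.1 (same kind of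
thresholds), (3.49) holds with an O(1) depending on d, L only. [cite: Balaban1985BackgroundPropagators, (3.49) p.399] -/
def Stmt349Printed {I : Type} (d : ℕ) (c35 : ℝ) (geo : I → Geometry) (bg : I → Backgrounds)
    (P : ∀ i, FineKernel (geo i) (bg i)) : Prop :=
  ∃ M₁ δ₀ a₀ C : ℝ, 0 < M₁ ∧ 0 < δ₀ ∧ 0 < a₀ ∧ 0 < C ∧
    ∀ i : I, M₁ ≤ (geo i).M → ∀ α₀ : ℝ, 0 < α₀ → (geo i).M * α₀ ≤ a₀ →
      ∀ U : (bg i).Cfg, (bg i).Reg335 c35 α₀ U → Ineq349 d (P i) C δ₀ U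

/-! ### "Theorems 3.1–3.3 hold for the operators …" — the recurring conclusion (Cor. 3.5, Cor. 3.6, Sect. B, p. 409) -/

/-- "The inequalities of Theorems 3.1–3.3 hold at the configuration U": (3.42)–(3.47) for G′ (`Gp`) and for G
(`GA`) with constants (B₀, δ₀, B₀(·), B′₀(·), B′₀(·,·)) (Thm 3.3: "with the constants described there"), and
(3.48) for (Q′G′²Q′*)^{−1} (`Cinv`) with constants (B₁, δ₁) (the print has B₁ = B₀, δ₁ = δ₀: "with the same
constants"; kept separate here so that no sign facts of the abstract carrier are needed to merge r1's two
typed blocks — cell DIVERGENCE row D-b09.1, harmless: max/min). [cite: Balaban1985BackgroundPropagators, Thms 3.1–3.3 pp.397–399] -/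
def Thms31to33IneqAt (d : ℕ) (Gp GA : KernelFamily g B) (Cinv : SiteKernel g B) (B₀ δ₀ : ℝ)
    (Bβ Bε : ℝ → ℝ) (Bεβ : ℝ → ℝ → ℝ) (B₁ δ₁ : ℝ) (U : B.Cfg) : Prop :=
  (Ineq342_346_347 Gp B₀ δ₀ U ∧ Ineq343_345 Gp Bβ Bε Bεβ δ₀ U) ∧
  (∀ y y' : g.Site, |Cinv.ker U y y'| ≤
      B₁ * (g.len y) ^ (-(4 : ℝ)) * (g.len y') ^ (-(d : ℝ)) * Real.exp (-(δ₁ * g.dist y y'))) ∧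
  (Ineq342_346_347 GA B₀ δ₀ U ∧ Ineq343_345 GA Bβ Bε Bεβ δ₀ U)

/-! ### Sect. B — the conditional step; "Thus Theorem 3.4 is proved, assuming that Theorems 3.1–3.3 hold" (p. 407) -/

/-- **Sect. B as printed** (pp. 400–407 [PDF 12–19]) — its CONDITIONAL content, typed as the by-reference leaf
it is: for a configuration U satisfying (3.35) with Mα₀ small (used at (3.69) and (3.78)–(3.81): *"for Mα₀, α₁
sufficiently small"*) at which the inequalities of Theorems 3.1–3.3 hold with given constants, the operators
extend analytically to U′U on the class (3.37) with α₁ ≤ a₁ and satisfy the same inequalities with new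
constants depending on the old ones and d, L only (an M-threshold M₀ is allowed, as everywhere in the paper) — p. 402 after (3.64): *"applying Theorem 3.1 for G′(U), the
inequalities (3.63), (3.64), and Lemma 2.1 of [4] we can prove all the statements (3.42)–(3.47) for the
operator G′(U′U), of course with different constants"*; (3.65)–(3.67): *"The inverse satisfies Theorem 3.2"*;
p. 407 after (3.86): *"Thus Theorem 3.4 is proved, assuming that Theorems 3.1–3.3 hold."*  Certified
mechanism: resolvent identities + Neumann series (3.62)–(3.64), (3.86) (C-B9-1); Hölder entries
asserted-routine (G-B9-02); B7 Props 4, 6 applied to COMPLEX U′U at (3.55)–(3.59), (3.78)–(3.81) (G-B7-05).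
`IsAnalyticExt` as in `Thm34Printed`. [cite: Balaban1985BackgroundPropagators, Sect. B (3.62)–(3.67) + (3.86) pp.402–407] -/
def SectBStepPrinted {I : Type} (d : ℕ) (c35 : ℝ) (geo : I → Geometry) (bg : I → Backgrounds)
    (Gp GA : ∀ i, KernelFamily (geo i) (bg i)) (Cinv : ∀ i, SiteKernel (geo i) (bg i))
    (IsAnalyticExt : ∀ i, KernelFamily (geo i) (bg i) → (bg i).Cfg → ℝ → Prop) : Prop :=
  ∀ (B₀ δ₀ : ℝ) (Bβ Bε : ℝ → ℝ) (Bεβ : ℝ → ℝ → ℝ) (B₁ δ₁ : ℝ),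
    ∃ M₀ a₁ a₀' B₀' δ₀' : ℝ, ∃ Bβ' Bε' : ℝ → ℝ, ∃ Bεβ' : ℝ → ℝ → ℝ, ∃ B₁' δ₁' : ℝ,
      0 < M₀ ∧ 0 < a₁ ∧ 0 < a₀' ∧ 0 < B₀' ∧ 0 < δ₀' ∧ 0 < B₁' ∧ 0 < δ₁' ∧
      ∀ i : I, M₀ ≤ (geo i).M → ∀ α₀ : ℝ, 0 < α₀ → (geo i).M * α₀ ≤ a₀' →
        ∀ U : (bg i).Cfg, (bg i).Reg335 c35 α₀ U →
        Thms31to33IneqAt d (Gp i) (GA i) (Cinv i) B₀ δ₀ Bβ Bε Bεβ B₁ δ₁ U →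
        ∀ α₁ : ℝ, 0 < α₁ → α₁ ≤ a₁ →
          IsAnalyticExt i (Gp i) U α₁ ∧ IsAnalyticExt i (GA i) U α₁ ∧
          ∀ U' : (bg i).Cfg, (bg i).Cplx337 α₁ U U' →
            Thms31to33IneqAt d (Gp i) (GA i) (Cinv i) B₀' δ₀' Bβ' Bε' Bεβ' B₁' δ₁' ((bg i).mul U' U)

/-- **p. 407 [PDF 19], kernel-checked bookkeeping** of the printed sentence *"Thus Theorem 3.4 is proved,
assuming that Theorems 3.1–3.3 hold"*: the Sect. B step (`SectBStepPrinted`, by-reference leaf) and Theorems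
3.2, 3.3 as typed above (r1's `Thm33Printed` carries Theorem 3.1's block for G′) give Theorem 3.4 as typed above (M-threshold = max, α₀-threshold = min of the printed
ones). [cite: Balaban1985BackgroundPropagators, Sect. B p.407] -/
theorem thm34_of_sectB {I : Type} (d : ℕ) (c35 : ℝ) (geo : I → Geometry) (bg : I → Backgrounds)
    (Gp GA : ∀ i, KernelFamily (geo i) (bg i)) (Cinv : ∀ i, SiteKernel (geo i) (bg i))
    (IsAnalyticExt : ∀ i, KernelFamily (geo i) (bg i) → (bg i).Cfg → ℝ → Prop)
    (hB : SectBStepPrinted d c35 geo bg Gp GA Cinv IsAnalyticExt)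
    (h2 : Thm32Printed d c35 geo bg Cinv) (h3 : Thm33Printed c35 geo bg Gp GA) :
    Thm34Printed c35 geo bg Gp GA IsAnalyticExt := by
  obtain ⟨M₁, δ₀, a₀, B₀, hM, -, ha, -, H⟩ := h2
  obtain ⟨M₁', δ₃, a₀', B₃, Bβ₃, Bε₃, Bεβ₃, hM', -, ha', -, H'⟩ := h3
  obtain ⟨M₀, a₁, a₀'', B₀', δ₀', Bβ', Bε', Bεβ', B₁', δ₁', -, ha₁, ha'', hB0', hδ0', -, -, HB⟩ :=
    hB B₃ δ₃ Bβ₃ Bε₃ Bεβ₃ B₀ δ₀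
  refine ⟨a₁, max (max M₁ M₁') M₀, δ₀', min a₀ (min a₀' a₀''), B₀', Bβ', Bε', Bεβ', ha₁,
    lt_max_of_lt_left (lt_max_of_lt_left hM), hδ0', lt_min ha (lt_min ha' ha''), hB0', ?_⟩
  intro i hMi α₀ α₁ hα hMa hα₁ hα₁a U hU
  have hMi1 : M₁ ≤ (geo i).M := le_trans (le_trans (le_max_left _ _) (le_max_left _ _)) hMi
  have hMi2 : M₁' ≤ (geo i).M := le_trans (le_trans (le_max_right _ _) (le_max_left _ _)) hMi
  have hMi0 : M₀ ≤ (geo i).M := le_trans (le_max_right _ _) hMi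
  have hMa1 : (geo i).M * α₀ ≤ a₀ := le_trans hMa (min_le_left _ _)
  have hMa2 : (geo i).M * α₀ ≤ a₀' := le_trans (le_trans hMa (min_le_right _ _)) (min_le_left _ _)
  have hMa3 : (geo i).M * α₀ ≤ a₀'' := le_trans (le_trans hMa (min_le_right _ _)) (min_le_right _ _)
  have hC := H i hMi1 α₀ hα hMa1 U hU
  obtain ⟨hGp, hGA⟩ := H' i hMi2 α₀ hα hMa2 U hU
  have hAt : Thms31to33IneqAt d (Gp i) (GA i) (Cinv i) B₃ δ₃ Bβ₃ Bε₃ Bεβ₃ B₀ δ₀ U := ⟨hGp, hC, hGA⟩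
  obtain ⟨hA1, hA2, hext⟩ := HB i hMi0 α₀ hα hMa3 U hU hAt α₁ hα₁ hα₁a
  refine ⟨hA1, hA2, fun U' hU' => ?_⟩
  obtain ⟨h1, -, h3⟩ := hext U' hU'
  exact ⟨h1.1, h1.2, h3.1, h3.2⟩

/-! ### Corollary 3.5 (full statement) and its induction base; Corollary 3.6 and the gauge reduction -/

/-- The INDUCTION BASE of the paper as printed on p. 407 [PDF 19]: *"we can use the results of [4]. There we
have proved these theorems for operators with the external gauge field configuration U = 1"* — i.e. Theorems
3.1–3.3 at U = 1 (for M ≥ M₁, constants depending on d, L only), imported from B6 = [4]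
[Balaban1984PropagatorsII]: Prop. 2.2 (2.67) p. 234 (G′: entries (3.42), (3.43)), Prop. 2.3 (2.87) p. 238
((3.48)), Prop. 2.6 (2.136)–(2.140) p. 247 (G: (3.42)–(3.46)), the global entries (3.47) "consequences of
the local ones and Lemma 2.1" (p. 398).  By-reference LEAF; the entry-by-entry match is GAPS G-B9-03 with the
residual G-B9-03a ((3.44)–(3.46) for G′ at U = 1 have no printed B6 counterpart) and the parameter-range note
G-B9-13 ((3.44) at ε = 1 and (3.45) for β + ε ≥ 1 exceed the ranges of (2.138)–(2.139); repaired by the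
monotonicity of lattice Hölder norms in the exponent — one line, not in print). [cite: Balaban1985BackgroundPropagators, Cor. 3.5 proof p.407] -/
def BaseU1Printed {I : Type} (d : ℕ) (geo : I → Geometry) (bg : I → Backgrounds)
    (Gp GA : ∀ i, KernelFamily (geo i) (bg i)) (Cinv : ∀ i, SiteKernel (geo i) (bg i)) : Prop :=
  ∃ M₁ B₀ δ₀ : ℝ, ∃ Bβ Bε : ℝ → ℝ, ∃ Bεβ : ℝ → ℝ → ℝ, ∃ B₁ δ₁ : ℝ,
    0 < M₁ ∧ 0 < B₀ ∧ 0 < δ₀ ∧ 0 < B₁ ∧ 0 < δ₁ ∧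
    ∀ i : I, M₁ ≤ (geo i).M → Thms31to33IneqAt d (Gp i) (GA i) (Cinv i) B₀ δ₀ Bβ Bε Bεβ B₁ δ₁ (bg i).one

/-- Bookkeeping (kernel-checked): the induction base in the form above contains r1's `Cor35_U1_Shape`. [folklore] -/
theorem cor35_U1_shape_of_base {I : Type} (d : ℕ) (geo : I → Geometry) (bg : I → Backgrounds)
    (Gp GA : ∀ i, KernelFamily (geo i) (bg i)) (Cinv : ∀ i, SiteKernel (geo i) (bg i))
    (h : BaseU1Printed d geo bg Gp GA Cinv) : Cor35_U1_Shape geo bg Gp GA := by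
  obtain ⟨M₁, B₀, δ₀, Bβ, Bε, Bεβ, B₁, δ₁, hM, hB, hδ, -, -, H⟩ := h
  exact ⟨M₁, δ₀, B₀, Bβ, Bε, Bεβ, hM, hδ, hB, fun i hMi => ⟨(H i hMi).1, (H i hMi).2.2⟩⟩

/-- **Corollary 3.5** (p. 407 [PDF 19], verbatim, FULL statement): *"If a configuration U′ is in the domain
(3.37) with U = 1 and α₁ ≤ a₁, then Theorems 3.1–3.3 hold for the operators G′(U′), (Q′(U′)G′²(U′)Q′*(U′))^{−1},
G(U′) correspondingly."*  (U′ = U′·1 is a COMPLEX configuration of the class (3.37) around U = 1; "Theorems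
3.1–3.3 hold" = their inequalities with constants depending on d, L only, for M ≥ M₁.)  Supersedes the
shape-only `Cor35_U1_Shape`. [cite: Balaban1985BackgroundPropagators, Cor. 3.5 p.407] -/
def Cor35Printed {I : Type} (d : ℕ) (geo : I → Geometry) (bg : I → Backgrounds)
    (Gp GA : ∀ i, KernelFamily (geo i) (bg i)) (Cinv : ∀ i, SiteKernel (geo i) (bg i)) : Prop :=
  ∃ a₁ M₁ B₀ δ₀ : ℝ, ∃ Bβ Bε : ℝ → ℝ, ∃ Bεβ : ℝ → ℝ → ℝ, ∃ B₁ δ₁ : ℝ,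
    0 < a₁ ∧ 0 < M₁ ∧ 0 < B₀ ∧ 0 < δ₀ ∧ 0 < B₁ ∧ 0 < δ₁ ∧
    ∀ i : I, M₁ ≤ (geo i).M → ∀ α₁ : ℝ, 0 < α₁ → α₁ ≤ a₁ →
      ∀ U' : (bg i).Cfg, (bg i).Cplx337 α₁ (bg i).one U' →
        Thms31to33IneqAt d (Gp i) (GA i) (Cinv i) B₀ δ₀ Bβ Bε Bεβ B₁ δ₁ ((bg i).mul U' (bg i).one)

/-- **Cor. 3.5 from its printed proof** (p. 407, kernel-checked bookkeeping): the induction base U = 1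
(`BaseU1Printed`, = the B6 import) fed into the Sect. B step (`SectBStepPrinted`) gives Corollary 3.5 — given
that U = 1 satisfies the regularity condition (3.35) for every α₀ > 0 (A = 0; `hone`, a fact of the model).
The M-threshold of the conclusion is max(M₁, 1, M₀) (M > 0 is used when choosing α₀ = a₀′/M). [cite: Balaban1985BackgroundPropagators, Cor. 3.5 proof p.407] -/
theorem cor35_of_sectB_base {I : Type} (d : ℕ) (c35 : ℝ) (geo : I → Geometry) (bg : I → Backgrounds)
    (Gp GA : ∀ i, KernelFamily (geo i) (bg i)) (Cinv : ∀ i, SiteKernel (geo i) (bg i))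
    (IsAnalyticExt : ∀ i, KernelFamily (geo i) (bg i) → (bg i).Cfg → ℝ → Prop)
    (hone : ∀ i : I, ∀ α₀ : ℝ, 0 < α₀ → (bg i).Reg335 c35 α₀ (bg i).one)
    (hbase : BaseU1Printed d geo bg Gp GA Cinv)
    (hB : SectBStepPrinted d c35 geo bg Gp GA Cinv IsAnalyticExt) :
    Cor35Printed d geo bg Gp GA Cinv := by
  obtain ⟨M₁, B₀, δ₀, Bβ, Bε, Bεβ, B₁, δ₁, hM, -, -, -, -, H⟩ := hbase
  obtain ⟨M₀, a₁, a₀', B₀', δ₀', Bβ', Bε', Bεβ', B₁', δ₁', -, ha₁, ha', hB0', hδ0', hB1', hδ1', HB⟩ :=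
    hB B₀ δ₀ Bβ Bε Bεβ B₁ δ₁
  refine ⟨a₁, max (max M₁ 1) M₀, B₀', δ₀', Bβ', Bε', Bεβ', B₁', δ₁', ha₁,
    lt_max_of_lt_left (lt_max_of_lt_left hM), hB0', hδ0', hB1', hδ1', ?_⟩
  intro i hMi α₁ hα₁ hα₁a U' hU'
  have hMpos : 0 < (geo i).M :=
    lt_of_lt_of_le one_pos (le_trans (le_trans (le_max_right _ _) (le_max_left _ _)) hMi)
  have hMi1 : M₁ ≤ (geo i).M := le_trans (le_trans (le_max_left _ _) (le_max_left _ _)) hMi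
  have hMi0 : M₀ ≤ (geo i).M := le_trans (le_max_right _ _) hMi
  set α₀ : ℝ := a₀' / (geo i).M with hα₀
  have hα₀pos : 0 < α₀ := div_pos ha' hMpos
  have hMa : (geo i).M * α₀ ≤ a₀' := by
    rw [hα₀, mul_div_cancel₀ _ (ne_of_gt hMpos)]
  obtain ⟨-, -, hext⟩ := HB i hMi0 α₀ hα₀pos hMa (bg i).one (hone i α₀ hα₀pos) (H i hMi1) α₁ hα₁ hα₁a
  exact hext U' hU'

/-- **The gauge reduction used for Cor. 3.6 and on p. 409** (pp. 407–408 [PDF 19–20]), typed as the by-reference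
leaf it is: for a family member whose domains satisfy Ω′₀ ⊂ □ for a cube □ of the (3.35) class (`InCube i`),
a configuration U satisfying (3.35) is, on □, gauge equivalent to U′·1 with U′ = e^{iηA} in the class (3.37)
around U = 1 with α₁ = O(1)Mα₀ (verbatim p. 408 [PDF 20], ll. 1–6: *"… and such that Ω′₀ ⊂ □, where □ is one of
the cubes appearing in the formulation of (3.35). For simplicity we have assumed that j = k, otherwise we can rescale
from η-lattice to L^{−j}-lattice. Applying the gauge transformation u we get U′ = U^u = e^{iηA} with A satisfying the
inequalities in (3.35) for j = k. This implies that U′ satisfies (3.37) for the sequence {Ω′_j}, with U = 1 and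
α₁ = O(1)Mα₀. Assuming O(1)Mα₀ ≦ a₁ we can apply the above Corollary and we get [Corollary 3.6]"*; quotation
corrected in revision v4.1 per census G-pv10-1 (a) — the earlier docstring carried a paraphrase in quotation marks),
and all the inequalities of Theorems 3.1–3.3 are gauge invariant ((3.28)–(3.34); p. 398: *"All these inequalities
are invariant with respect to gauge transformations of U"*; p. 408: *"we have to recall only that all the results of
these theorems are gauge invariant"*), so they transfer from the operators at U′·1 to those at U.  GAPS G-B9-14
(certified-routine: (3.34) + unitary invariance of the HS norm). [cite: Balaban1985BackgroundPropagators, (3.28)–(3.35) pp.395–396 + Cor. 3.6 proof p.408] -/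
def GaugeReduction335 {I : Type} (d : ℕ) (c35 : ℝ) (geo : I → Geometry) (bg : I → Backgrounds)
    (InCube : I → Prop) (Gp GA : ∀ i, KernelFamily (geo i) (bg i)) (Cinv : ∀ i, SiteKernel (geo i) (bg i)) :
    Prop :=
  ∀ i : I, InCube i → ∀ (α₀ : ℝ) (U : (bg i).Cfg), 0 < α₀ → (bg i).Reg335 c35 α₀ U →
    ∃ U' : (bg i).Cfg, (bg i).Cplx337 (c35 * (geo i).M * α₀) (bg i).one U' ∧
      ∀ (B₀ δ₀ : ℝ) (Bβ Bε : ℝ → ℝ) (Bεβ : ℝ → ℝ → ℝ) (B₁ δ₁ : ℝ),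
        Thms31to33IneqAt d (Gp i) (GA i) (Cinv i) B₀ δ₀ Bβ Bε Bεβ B₁ δ₁ ((bg i).mul U' (bg i).one) →
        Thms31to33IneqAt d (Gp i) (GA i) (Cinv i) B₀ δ₀ Bβ Bε Bεβ B₁ δ₁ U

/-- **Corollary 3.6** (p. 408 [PDF 20], verbatim): *"If a configuration U satisfies (3.35) with O(1)Mα₀ ≤ a₁,
and Ω′₀ ⊂ □ for a cube □ of the class described in this condition, then Theorems 3.1–3.3 hold for the operators
G′(U), (Q′(U)G′²(U)Q′*(U))^{−1}, G(U) constructed for the sequence {Ω′_j}."*  (p. 408: *"Corollary 3.6 gives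
crucial results for our future considerations."*)  `InCube i` = the family member's domains satisfy Ω′₀ ⊂ □; `c35` = the
O(1) of (3.35). [cite: Balaban1985BackgroundPropagators, Cor. 3.6 p.408] -/
def Cor36Printed {I : Type} (d : ℕ) (c35 : ℝ) (geo : I → Geometry) (bg : I → Backgrounds)
    (InCube : I → Prop) (Gp GA : ∀ i, KernelFamily (geo i) (bg i)) (Cinv : ∀ i, SiteKernel (geo i) (bg i)) :
    Prop :=
  ∃ a₁ M₁ B₀ δ₀ : ℝ, ∃ Bβ Bε : ℝ → ℝ, ∃ Bεβ : ℝ → ℝ → ℝ, ∃ B₁ δ₁ : ℝ,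
    0 < a₁ ∧ 0 < M₁ ∧ 0 < B₀ ∧ 0 < δ₀ ∧ 0 < B₁ ∧ 0 < δ₁ ∧
    ∀ i : I, InCube i → M₁ ≤ (geo i).M → ∀ α₀ : ℝ, 0 < α₀ → c35 * (geo i).M * α₀ ≤ a₁ →
      ∀ U : (bg i).Cfg, (bg i).Reg335 c35 α₀ U →
        Thms31to33IneqAt d (Gp i) (GA i) (Cinv i) B₀ δ₀ Bβ Bε Bεβ B₁ δ₁ U

/-- **Cor. 3.6 from its printed proof** (p. 408 [PDF 20], kernel-checked bookkeeping): Corollary 3.5 and the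
gauge reduction give Corollary 3.6 with the SAME constants and the same a₁ (for c35 > 0). [cite: Balaban1985BackgroundPropagators, Cor. 3.6 proof p.408] -/
theorem cor36_of_cor35 {I : Type} (d : ℕ) (c35 : ℝ) (hc : 0 < c35) (geo : I → Geometry) (bg : I → Backgrounds)
    (InCube : I → Prop) (Gp GA : ∀ i, KernelFamily (geo i) (bg i)) (Cinv : ∀ i, SiteKernel (geo i) (bg i))
    (h35 : Cor35Printed d geo bg Gp GA Cinv) (hg : GaugeReduction335 d c35 geo bg InCube Gp GA Cinv) :
    Cor36Printed d c35 geo bg InCube Gp GA Cinv := by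
  obtain ⟨a₁, M₁, B₀, δ₀, Bβ, Bε, Bεβ, B₁, δ₁, ha₁, hM, hB0, hδ0, hB1, hδ1, H⟩ := h35
  refine ⟨a₁, M₁, B₀, δ₀, Bβ, Bε, Bεβ, B₁, δ₁, ha₁, hM, hB0, hδ0, hB1, hδ1, ?_⟩
  intro i hi hMi α₀ hα hsmall U hU
  have hMpos : 0 < (geo i).M := lt_of_lt_of_le hM hMi
  obtain ⟨U', hU', htr⟩ := hg i hi α₀ U hα hU
  have hα₁ : 0 < c35 * (geo i).M * α₀ := by positivity
  exact htr B₀ δ₀ Bβ Bε Bεβ B₁ δ₁ (H i hMi _ hα₁ hsmall U' hU')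

/-! ### Sect. C — generalized random walk expansions: Theorem 3.7, Corollary 3.8, Theorem 3.9, Theorem 3.10 -/

/-- A GENERALIZED RANDOM WALK EXPANSION of an operator acting on arguments λ (or J), seen through this file's
carriers (Sect. C, pp. 408–416): `Walk` = the walks ω (= (□₀, …, □ₙ) in (3.90), ((0, X₀), (α₁, X₁), …) in
(3.107)); `wlen ω` = |ω| = n; `first ω y` = y ∈ □₀ ∩ Λ_j (resp. X₀), `last ω y′` = y′ ∈ □ₙ (resp. Xₙ);
`wdist ω y y′` = d(ω, y, y′) of (3.93); `term U ω λ y` = the sup quantity |Δ(y)·(ω-term of the expansion at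
U)·Δ(y′)λ| of (3.94)/(3.108); `LocDep U ω` = "the term … depends on U restricted to X̃⁵₀ ∪ … ∪ X̃⁵ₙ";
`Converges U` = "the operator is represented by the expansion, convergent in all norms appearing in the
inequalities (3.42)–(3.47)".  The file never constructs an instance. [cite: Balaban1985BackgroundPropagators, (3.90)–(3.94) + (3.107)–(3.108) pp.409–416] -/
structure RWExpansion (g : Geometry) (B : Backgrounds) where
  Walk : Type
  wlen : Walk → ℕ
  first : Walk → g.Site → Prop
  last : Walk → g.Site → Prop
  wdist : Walk → g.Site → g.Site → ℝ
  term : B.Cfg → Walk → g.Loc → g.Site → ℝ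
  LocDep : B.Cfg → Walk → Prop
  Converges : B.Cfg → Prop

/-- The same for an operator given by a KERNEL on 𝔅 ((Q′G′²Q′*)^{−1}, (3.98)–(3.99)): `kterm U ω y y′` = |(ω-term)(y, y′)|. [cite: Balaban1985BackgroundPropagators, (3.98)–(3.99) p.413] -/
structure RWKernelExpansion (g : Geometry) (B : Backgrounds) where
  Walk : Type
  wlen : Walk → ℕ
  wdist : Walk → g.Site → g.Site → ℝ
  kterm : B.Cfg → Walk → g.Site → g.Site → ℝ
  LocDep : B.Cfg → Walk → Prop
  Converges : B.Cfg → Prop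

/-- The walk-term bound factor O(1)·(O(1)M^{−1/2})^{|ω|}·M^{−½|ω|}·e^{−½δ₀d(ω,y,y′)} common to (3.94), (3.99),
(3.108) (with the two O(1)'s = C, c). [cite: Balaban1985BackgroundPropagators, (3.94) p.410] -/
noncomputable def walkFactor (C c M δ₀ : ℝ) (n : ℕ) (dω : ℝ) : ℝ :=
  C * (c * M ^ (-(1 / 2 : ℝ))) ^ n * M ^ (-((n : ℝ) / 2)) * Real.exp (-(δ₀ / 2 * dω))

/-- **Theorem 3.7** (p. 409 [PDF 21], verbatim): *"For M sufficiently large, and a configuration U satisfying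
(3.35), the operator G′ can be represented as G′ = G′₀(I − R′)^{−1} = G′₀Σ_{n=0}^∞R′^n
= Σ_ω h_{□₀}G′_{□₀}h_{□₀}K(h_{□₁})G′_{□₁}h_{□₁}·⋯·K(h_{□ₙ})G′_{□ₙ}h_{□ₙ}, (3.90) where ω = (□₀, □₁, ⋯, □ₙ),
□ᵢ ∈ 𝒟, □ᵢ ∩ □ᵢ₊₁ ≠ ∅.  The expansion is convergent in all norms appearing in the inequalities (3.42)–(3.47)."*
((3.35) carries the standing smallness O(1)Mα₀ ≤ a₁ of Cor. 3.6, which the proof invokes for every G′_□;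
typed as the α₀-threshold a₀.)  Printed proof: *"follows simply from Corollary 3.6 holding for all G′_□,
□ ∈ 𝒟, from the bound (3.89) and Lemma 2.1. The arguments are exactly the same as in proofs of Proposition
1.2 [3] and Proposition 2.2 [4], so we will not repeat them here"* (GAPS G-B9-07). [cite: Balaban1985BackgroundPropagators, Thm 3.7 (3.90) p.409] -/
def Thm37Printed {I : Type} (c35 : ℝ) (geo : I → Geometry) (bg : I → Backgrounds)
    (E : ∀ i, RWExpansion (geo i) (bg i)) : Prop :=
  ∃ M₂ a₀ : ℝ, 0 < M₂ ∧ 0 < a₀ ∧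
    ∀ i : I, M₂ ≤ (geo i).M → ∀ α₀ : ℝ, 0 < α₀ → (geo i).M * α₀ ≤ a₀ →
      ∀ U : (bg i).Cfg, (bg i).Reg335 c35 α₀ U → (E i).Converges U

/-- **Corollary 3.8** (p. 410 [PDF 22], verbatim): *"The term in the expansion (3.90) corresponding to a walk
ω = (□₀, □₁, …, □ₙ) depends on U restricted to □̃⁵₀ ∪ □̃⁵₁ ∪ … ∪ □̃⁵ₙ, and
|Δ(y)h_{□₀}G′_{□₀}h_{□₀}Π_{i=1}^n K(h_{□ᵢ})G′_{□ᵢ}h_{□ᵢ}Δ(y′)λ| ≤ O(1)(L^jη)²O(M^{−1/2})^{|ω|}M^{−1/2|ω|}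
e^{−(1/2)δ₀d(ω,y,y′)}|Δ(y′)λ| (3.94) for y ∈ □₀ ∩ Λ_j, y′ ∈ □ₙ.  Similar estimates hold for the other norms."*
(d(ω, y, y′) = (3.93); same standing hypotheses as Thm 3.7.)  Certified arithmetic behind (3.94) ⇐ (3.92):
`split_small_factor` ((cM^{−1})^n = (cM^{−1/2})^n M^{−n/2}); convergence of the walk sum for M ≥ 2Nc:
`walkSum_le` (C-B9-7). [cite: Balaban1985BackgroundPropagators, Cor. 3.8 (3.93)–(3.94) p.410] -/
def Cor38Printed {I : Type} (c35 : ℝ) (geo : I → Geometry) (bg : I → Backgrounds)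
    (E : ∀ i, RWExpansion (geo i) (bg i)) : Prop :=
  ∃ M₂ a₀ δ₀ C c : ℝ, 0 < M₂ ∧ 0 < a₀ ∧ 0 < δ₀ ∧ 0 < C ∧ 0 < c ∧
    ∀ i : I, M₂ ≤ (geo i).M → ∀ α₀ : ℝ, 0 < α₀ → (geo i).M * α₀ ≤ a₀ →
      ∀ U : (bg i).Cfg, (bg i).Reg335 c35 α₀ U →
        ∀ (ω : (E i).Walk) (lam : (geo i).Loc) (y y' : (geo i).Site),
          (E i).first ω y → (E i).last ω y' → (geo i).suppIn lam y' →
            (E i).LocDep U ω ∧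
            (E i).term U ω lam y ≤ ((geo i).len y) ^ 2 *
              walkFactor C c (geo i).M δ₀ ((E i).wlen ω) ((E i).wdist ω y y') * (geo i).supNorm lam

/-- **Theorem 3.9** (p. 413 [PDF 25], verbatim): *"For M sufficiently large, and a configuration U satisfying
(3.35), the operator Q′G′²Q′* has an inverse which can be represented as (Q′G′²Q′*)^{−1} = Σ_ω R′₀(X₀)R′_{α₁}(X₁)·
⋯·R′_{αₙ}(Xₙ) (3.98) the sum is over walks ω = ((0, X₀), (α₁, X₁), …, (αₙ, Xₙ)) satisfying X_{i−1} ∩ Xᵢ ≠ ∅,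
i = 1, …, n.  A term in this expansion corresponding to a walk ω depends on U restructed [sic] to X̃⁵₀ ∪ X̃⁵₁ ∪
… ∪ X̃⁵ₙ, and has the following bound: |(R′₀(X₀)R′_{α₁}(X₁)·⋯·R′_{αₙ}(Xₙ))(y, y′)| ≤ O(1)(L^jη)^{−4}(L^{j′}η)^{−d}·
O(M^{−1/2})^{|ω|}M^{−1/2|ω|}e^{−1/2δ₀d(ω,y,y′)}, y ∈ Λ_j, y′ ∈ Λ_{j′}. (3.99)  The distance d(ω, y, y′) is defined
by (3.93), but the infimum is taken over yᵢ ∈ Xᵢ ∩ 𝔅."*  Preceded by (p. 413): *"An operator R(X) … satisfies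
a bound of the type (3.89), possibly with an additional power of L^jη. It is difficult to make the last statement
more precise. Instead we will write a bound for a whole term in the expansion"* (GAPS G-B9-07).  Followed by:
*"This theorem implies Theorem 3.2."* (`thm32_of_thm39`). [cite: Balaban1985BackgroundPropagators, Thm 3.9 (3.98)–(3.99) p.413] -/
def Thm39Printed {I : Type} (d : ℕ) (c35 : ℝ) (geo : I → Geometry) (bg : I → Backgrounds)
    (E : ∀ i, RWKernelExpansion (geo i) (bg i)) : Prop :=
  ∃ M₂ a₀ δ₀ C c : ℝ, 0 < M₂ ∧ 0 < a₀ ∧ 0 < δ₀ ∧ 0 < C ∧ 0 < c ∧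
    ∀ i : I, M₂ ≤ (geo i).M → ∀ α₀ : ℝ, 0 < α₀ → (geo i).M * α₀ ≤ a₀ →
      ∀ U : (bg i).Cfg, (bg i).Reg335 c35 α₀ U →
        (E i).Converges U ∧
        ∀ (ω : (E i).Walk) (y y' : (geo i).Site), (E i).LocDep U ω ∧
          |(E i).kterm U ω y y'| ≤ ((geo i).len y) ^ (-(4 : ℝ)) * ((geo i).len y') ^ (-(d : ℝ)) *
            walkFactor C c (geo i).M δ₀ ((E i).wlen ω) ((E i).wdist ω y y')

/-- **Theorem 3.10** (pp. 415–416 [PDF 27–28], verbatim): *"For M sufficiently large, and a configuration U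
satisfying (3.95)[sic — (3.35), print slip G-B9-04], the operator G has the expansion G = Σ_ω R₀(X₀)R_{α₁}(X₁)·⋯·
R_{αₙ}(Xₙ), (3.107) the sum is over walks ω = ((0, X₀), (α₁, X₁), …, (αₙ, Xₙ)) satisfying X_{i−1} ∩ Xᵢ ≠ ∅,
i = 1, …, n.  A term in this expansion, corresponding to a walk ω, depends on configuration U restricted to
X̃⁵₀ ∪ X̃⁵₁ ∪ … ∪ X̃⁵ₙ, satisfies the inequality |(R₀(X₀)R_{α₁}(X₁)·⋯·R_{αₙ}(Xₙ)J)(x)| ≤ O(1)(L^jη)²O(M^{−1/2})^{|ω|}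
M^{−1/2|ω|}e^{−(1/2)δ₀d(ω,y,y′)}|J|, x ∈ Δ(y), y ∈ Λ_j, supp J ⊂ Δ(y′), (3.108) and the corresponding inequalities
for norms on the left-hand sides of (3.42)–(3.47).  The constant O(1) depends on d and L only."*  Followed by
(p. 416): *"From (3.108) it follows that the expansion (3.107) is convergent in all norms in the inequalities
(3.42)–(3.47). This implies Theorem 3.3. Thus we have completed the proofs of all theorems formulated until
now."* (`thm33_of_thm37_310`).  GAPS G-B9-07 (proof = pp. 413–415 sketch by reference to B6 (2.135)). [cite: Balaban1985BackgroundPropagators, Thm 3.10 (3.107)–(3.108) pp.415–416] -/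
def Thm310Printed {I : Type} (c35 : ℝ) (geo : I → Geometry) (bg : I → Backgrounds)
    (E : ∀ i, RWExpansion (geo i) (bg i)) : Prop :=
  ∃ M₂ a₀ δ₀ C c : ℝ, 0 < M₂ ∧ 0 < a₀ ∧ 0 < δ₀ ∧ 0 < C ∧ 0 < c ∧
    ∀ i : I, M₂ ≤ (geo i).M → ∀ α₀ : ℝ, 0 < α₀ → (geo i).M * α₀ ≤ a₀ →
      ∀ U : (bg i).Cfg, (bg i).Reg335 c35 α₀ U →
        (E i).Converges U ∧
        ∀ (ω : (E i).Walk) (J : (geo i).Loc) (y y' : (geo i).Site),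
          (E i).first ω y → (E i).last ω y' → (geo i).suppIn J y' →
            (E i).LocDep U ω ∧
            (E i).term U ω J y ≤ ((geo i).len y) ^ 2 *
              walkFactor C c (geo i).M δ₀ ((E i).wlen ω) ((E i).wdist ω y y') * (geo i).supNorm J

/-- The SUMMATION STEP of Sect. C as the by-reference leaf it is (p. 409: *"from the bound (3.89) and Lemma 2.1.
The arguments are exactly the same as in proofs of Proposition 1.2 [3] and Proposition 2.2 [4]"*; p. 416: *"From
(3.108) it follows that the expansion (3.107) is convergent in all norms in the inequalities (3.42)–(3.47)"*):
whenever the expansions (3.90) of G′ and (3.107) of G converge in the stated sense, the sums satisfy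
(3.42)–(3.47) with constants depending on d and L only (the SAME constants for G′ and G: Thm 3.3 "with the
constants described there").  GAPS G-B9-07; the convergence arithmetic is `walkSum_le`. [cite: Balaban1985BackgroundPropagators, Thm 3.7 proof p.409 + Thm 3.10 proof p.416] -/
def RWSumsYieldIneqs {I : Type} (geo : I → Geometry) (bg : I → Backgrounds)
    (E7 E10 : ∀ i, RWExpansion (geo i) (bg i)) (Gp GA : ∀ i, KernelFamily (geo i) (bg i)) : Prop :=
  ∃ B₀ δ₀ : ℝ, ∃ Bβ Bε : ℝ → ℝ, ∃ Bεβ : ℝ → ℝ → ℝ, 0 < B₀ ∧ 0 < δ₀ ∧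
    ∀ i : I, ∀ U : (bg i).Cfg,
      ((E7 i).Converges U → Ineq342_346_347 (Gp i) B₀ δ₀ U ∧ Ineq343_345 (Gp i) Bβ Bε Bεβ δ₀ U) ∧
      ((E10 i).Converges U → Ineq342_346_347 (GA i) B₀ δ₀ U ∧ Ineq343_345 (GA i) Bβ Bε Bεβ δ₀ U)

/-- The kernel-summation step for (3.98) (p. 413, *"This theorem implies Theorem 3.2"*), by-reference leaf:
convergence of (3.98) with the term bounds (3.99) gives the kernel bound (3.48) (sum over walks by
`walkSum_le`, e^{−½δ₀d(ω,y,y′)} ≤ e^{−½δ₀d(y,y′)}); constants depending on d, L only.  GAPS G-B9-07. [cite: Balaban1985BackgroundPropagators, Thm 3.9 p.413] -/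
def RWKernelSumYields {I : Type} (d : ℕ) (geo : I → Geometry) (bg : I → Backgrounds)
    (E9 : ∀ i, RWKernelExpansion (geo i) (bg i)) (Cinv : ∀ i, SiteKernel (geo i) (bg i)) : Prop :=
  ∃ B₀ δ₀ : ℝ, 0 < B₀ ∧ 0 < δ₀ ∧ ∀ i : I, ∀ U : (bg i).Cfg, (E9 i).Converges U →
    ∀ y y' : (geo i).Site, |(Cinv i).ker U y y'| ≤
      B₀ * ((geo i).len y) ^ (-(4 : ℝ)) * ((geo i).len y') ^ (-(d : ℝ)) * Real.exp (-(δ₀ * (geo i).dist y y'))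

/-- **p. 410 [PDF 22] ll. 4–5, kernel-checked bookkeeping**: *"Theorem 3.7 implies that all the inequalities
(3.42)–(3.47) hold for G′, thus we have completed the proof of Theorem 3.1"* — from Thm 3.7 as typed and the summation
leaf (page pointer corrected in v4.1, census D-pv17.1 (b)). [cite: Balaban1985BackgroundPropagators, Thm 3.7 ⇒ Thm 3.1 p.410] -/
theorem thm31_of_thm37 {I : Type} (c35 : ℝ) (geo : I → Geometry) (bg : I → Backgrounds)
    (E7 E10 : ∀ i, RWExpansion (geo i) (bg i)) (Gp GA : ∀ i, KernelFamily (geo i) (bg i))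
    (h37 : Thm37Printed c35 geo bg E7) (hsum : RWSumsYieldIneqs geo bg E7 E10 Gp GA) :
    Thm31Printed c35 geo bg Gp := by
  obtain ⟨M₂, a₀, hM, ha, H⟩ := h37
  obtain ⟨B₀, δ₀, Bβ, Bε, Bεβ, hB, hδ, S⟩ := hsum
  refine ⟨M₂, δ₀, a₀, B₀, Bβ, Bε, Bεβ, hM, hδ, ha, hB, ?_⟩
  intro i hMi α₀ hα hMa U hU
  exact (S i U).1 (H i hMi α₀ hα hMa U hU)

/-- **p. 413 [PDF 25], kernel-checked bookkeeping**: *"This theorem [3.9] implies Theorem 3.2."* [cite: Balaban1985BackgroundPropagators, Thm 3.9 ⇒ Thm 3.2 p.413] -/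
theorem thm32_of_thm39 {I : Type} (d : ℕ) (c35 : ℝ) (geo : I → Geometry) (bg : I → Backgrounds)
    (E9 : ∀ i, RWKernelExpansion (geo i) (bg i)) (Cinv : ∀ i, SiteKernel (geo i) (bg i))
    (h39 : Thm39Printed d c35 geo bg E9) (hsum : RWKernelSumYields d geo bg E9 Cinv) :
    Thm32Printed d c35 geo bg Cinv := by
  obtain ⟨M₂, a₀, δ₀, C, c, hM, ha, -, -, -, H⟩ := h39
  obtain ⟨B₀, δ₁, hB, hδ₁, S⟩ := hsum
  refine ⟨M₂, δ₁, a₀, B₀, hM, hδ₁, ha, hB, ?_⟩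
  intro i hMi α₀ hα hMa U hU
  exact S i U (H i hMi α₀ hα hMa U hU).1

/-- **p. 416 [PDF 28], kernel-checked bookkeeping**: *"From (3.108) it follows that the expansion (3.107) is
convergent … This implies Theorem 3.3. Thus we have completed the proofs of all theorems formulated until
now."* — Theorems 3.7 and 3.10 as typed plus the summation leaf give Theorem 3.3 as typed by r1 (which carries
the G′-block too). [cite: Balaban1985BackgroundPropagators, Thm 3.10 ⇒ Thm 3.3 p.416] -/
theorem thm33_of_thm37_310 {I : Type} (c35 : ℝ) (geo : I → Geometry) (bg : I → Backgrounds)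
    (E7 E10 : ∀ i, RWExpansion (geo i) (bg i)) (Gp GA : ∀ i, KernelFamily (geo i) (bg i))
    (h37 : Thm37Printed c35 geo bg E7) (h310 : Thm310Printed c35 geo bg E10)
    (hsum : RWSumsYieldIneqs geo bg E7 E10 Gp GA) : Thm33Printed c35 geo bg Gp GA := by
  obtain ⟨M₂, a₀, hM, ha, H⟩ := h37
  obtain ⟨M₃, a₃, δ₃, C, c, hM₃, ha₃, -, -, -, H'⟩ := h310
  obtain ⟨B₀, δ₀, Bβ, Bε, Bεβ, hB, hδ, S⟩ := hsum
  refine ⟨max M₂ M₃, δ₀, min a₀ a₃, B₀, Bβ, Bε, Bεβ, lt_max_of_lt_left hM, hδ, lt_min ha ha₃, hB, ?_⟩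
  intro i hMi α₀ hα hMa U hU
  have h1 := H i (le_trans (le_max_left _ _) hMi) α₀ hα (le_trans hMa (min_le_left _ _)) U hU
  have h2 := (H' i (le_trans (le_max_right _ _) hMi) α₀ hα (le_trans hMa (min_le_right _ _)) U hU).1
  exact ⟨(S i U).1 h1, (S i U).2 h2⟩

/-! ### The "M sufficiently large" arithmetic of Sects. B–C (kernel-checked second engine) -/

/-- C-B9-7 (kernel-checked), the convergence mechanism of (3.90), (3.96), (3.106) (pp. 409–414): if the number
of walks of length n from a fixed cube is ≤ N^n and each term of length n is ≤ C(c/M)^n, then for M ≥ 2Nc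
(i.e. Nc/M ≤ ½) every partial sum of the walk expansion is ≤ 2C — "for M sufficiently large". [folklore] -/
theorem walkSum_le (C x : ℝ) (cnt t : ℕ → ℝ) (hC : 0 ≤ C) (hx0 : 0 ≤ x) (hx : x ≤ 1 / 2)
    (ht : ∀ n, cnt n * t n ≤ C * x ^ n) (m : ℕ) :
    ∑ n ∈ Finset.range m, cnt n * t n ≤ 2 * C := by
  have hx1 : x ≠ 1 := by intro h; rw [h] at hx; norm_num at hx
  have hgeom : ∑ n ∈ Finset.range m, x ^ n ≤ 2 := by
    rw [geom_sum_eq hx1 m]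
    rw [div_le_iff_of_neg (by linarith)]
    nlinarith [pow_nonneg hx0 m]
  calc ∑ n ∈ Finset.range m, cnt n * t n ≤ ∑ n ∈ Finset.range m, C * x ^ n := Finset.sum_le_sum fun n _ => ht n
    _ = C * ∑ n ∈ Finset.range m, x ^ n := by rw [Finset.mul_sum]
    _ ≤ C * 2 := mul_le_mul_of_nonneg_left hgeom hC
    _ = 2 * C := by ring

/-- C-B9-7 (kernel-checked): the walk-counting instance — cnt n ≤ N^n walks of length n, each term ≤ C(c/M)^n,
and 2Nc ≤ M give partial sums ≤ 2C. [folklore] -/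
theorem walkSum_le_of_count (C N c M : ℝ) (cnt s : ℕ → ℝ) (hC : 0 ≤ C) (hN : 0 ≤ N) (hc : 0 ≤ c)
    (hM : 0 < M) (hbig : 2 * N * c ≤ M) (hcnt0 : ∀ n, 0 ≤ cnt n) (hcnt : ∀ n, cnt n ≤ N ^ n)
    (hs : ∀ n, s n ≤ C * (c / M) ^ n) (m : ℕ) :
    ∑ n ∈ Finset.range m, cnt n * s n ≤ 2 * C := by
  have hx0 : 0 ≤ N * c / M := by positivity
  have hx : N * c / M ≤ 1 / 2 := by
    rw [div_le_iff₀ hM]; linarith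
  refine walkSum_le C (N * c / M) cnt s hC hx0 hx (fun n => ?_) m
  have hcm : 0 ≤ C * (c / M) ^ n := by positivity
  calc cnt n * s n ≤ cnt n * (C * (c / M) ^ n) := mul_le_mul_of_nonneg_left (hs n) (hcnt0 n)
    _ ≤ N ^ n * (C * (c / M) ^ n) := mul_le_mul_of_nonneg_right (hcnt n) hcm
    _ = C * (N * c / M) ^ n := by rw [mul_div_assoc, mul_pow]; ring

/-- C-B9-8 (kernel-checked), the rewriting (3.92) ⇒ (3.94) p. 410: a small factor (cM^{−1})^n splits as
(cM^{−1/2})^n·M^{−n/2} — half is kept as the explicit M^{−½|ω|}, half absorbed into "O(M^{−1/2})^{|ω|}". [folklore] -/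
theorem split_small_factor (c M : ℝ) (hM : 0 < M) (n : ℕ) :
    (c * M⁻¹) ^ n = (c * M ^ (-(1 / 2 : ℝ))) ^ n * M ^ (-((n : ℝ) / 2)) := by
  have hs : M ^ (-(1 / 2 : ℝ)) * M ^ (-(1 / 2 : ℝ)) = M⁻¹ := by
    rw [← Real.rpow_add hM]; norm_num [Real.rpow_neg_one]
  have hn : M ^ (-((n : ℝ) / 2)) = (M ^ (-(1 / 2 : ℝ))) ^ n := by
    rw [← Real.rpow_natCast, ← Real.rpow_mul hM.le]; congr 1; ring
  rw [hn, ← mul_pow]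
  congr 1
  rw [mul_assoc, hs]

/-- C-B9-9 (kernel-checked), the geometric sum in (3.81) p. 405 (accumulated fluctuation of the averaged
configurations over the scales n < j): Σ_{n<j} L^{n−j} ≤ 1/(L − 1) for L > 1. [folklore] -/
theorem eq381_scale_sum (L : ℝ) (hL : 1 < L) (j : ℕ) :
    ∑ n ∈ Finset.range j, L ^ n / L ^ j ≤ 1 / (L - 1) := by
  rw [← Finset.sum_div, geom_sum_eq (ne_of_gt hL) j]
  have hLj : 0 < L ^ j := pow_pos (by linarith) j
  have hL1 : 0 < L - 1 := by linarith
  rw [div_div, div_le_div_iff₀ (by positivity) hL1]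
  nlinarith

/-- C-B9-10 (kernel-checked), the domain bookkeeping of p. 408 [PDF 20] ("Ω₀(□) ⊂ □̃⁵"): descending from
Ω_j(□) = □̃⁴ to Ω₀(□) each scale n < j adds a collar of width 2R₀M₀L^nη, in total 2R₀M₀η·Σ_{n<j}L^n, which
fits into the collar ML^jη = KR₀M₀L^jη between □̃⁴ and □̃⁵ as soon as K ≥ 2 (L ≥ 2): 2Σ_{n<j}L^n ≤ KL^j. [folklore] -/
theorem p408_domains_fit (L K : ℝ) (hL : 2 ≤ L) (hK : 2 ≤ K) (j : ℕ) :
    2 * ∑ n ∈ Finset.range j, L ^ n ≤ K * L ^ j := by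
  have hgeom : (∑ n ∈ Finset.range j, L ^ n) * (L - 1) = L ^ j - 1 := geom_sum_mul L j
  have hS0 : 0 ≤ ∑ n ∈ Finset.range j, L ^ n := Finset.sum_nonneg fun n _ => pow_nonneg (by linarith) n
  have hS : ∑ n ∈ Finset.range j, L ^ n ≤ L ^ j - 1 := by nlinarith
  have hLj : 0 ≤ L ^ j := pow_nonneg (by linarith) j
  nlinarith

/-- C-B9-11 (kernel-checked), p. 412 [PDF 24]: the exponential e^{−2δ₀M} traded for the small factor (2δ₀M)^{−1}
(e^{−s} ≤ s^{−1} for s > 0). [folklore] -/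
theorem exp_neg_le_inv (s : ℝ) (hs : 0 < s) : Real.exp (-s) ≤ s⁻¹ := by
  rw [Real.exp_neg, inv_le_inv₀ (Real.exp_pos s) hs]
  linarith [Real.add_one_le_exp s]

/-! ### Theorem 3.11 — the abstract positivity argument of p. 416 (kernel-checked over ℝ-inner product spaces) -/

/-- C-B9-12 (kernel-checked), the LINEAR-ALGEBRA CORE of the proof of Theorem 3.11 (p. 416 [PDF 28]) in the
form the text uses it: if B ≠ 0 and ⟨RB, B⟩ ≤ r‖B‖² with r < 1 then ⟨(I − R)B, B⟩ > 0 — so the quadratic form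
⟨(I − R)B, B⟩ cannot take the non-positive value −λ₀‖A₁‖² that a non-positive eigenvalue −λ₀ of the symmetric
operator G = G₀(I − R)^{−1} would force (with B = (I − R)^{−1}G₀^{1/2}A₁).  Typed over a real inner product
space; the eigenvector step and "R has small norm" in the L² sense are GAPS G-B9-06. [folklore] -/
theorem thm311_core {E : Type*} [NormedAddCommGroup E] [InnerProductSpace ℝ E] (R : E →ₗ[ℝ] E) (r : ℝ)
    (hr : r < 1) (hR : ∀ B : E, inner ℝ (R B) B ≤ r * ‖B‖ ^ 2) (B : E) (hB : B ≠ 0) :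
    0 < inner ℝ (B - R B) B := by
  have hn : 0 < ‖B‖ ^ 2 := by positivity
  have h1 : inner ℝ (B - R B) B = ‖B‖ ^ 2 - inner ℝ (R B) B := by
    rw [inner_sub_left, real_inner_self_eq_norm_sq]
  rw [h1]
  nlinarith [hR B]

/-! ### Sect. D — the operator identities (3.124), (3.146)–(3.147), p. 425, (3.150)–(3.153), kernel-checked
over an arbitrary ring from exactly the identities the text invokes -/

section SectDAlgebra

variable {A : Type*} [Ring A]

/-- The operator 𝔓 of (3.147) p. 425 [PDF 37] as a ring expression: 𝔓 = I − G₁Q*(QG₁Q*)^{−1}Q − G₁DRD* with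
g = G₁, qs = Q*, c = (QG₁Q*)^{−1}, q = Q, d = D, r = R, ds = D*. [cite: Balaban1985BackgroundPropagators, (3.147) p.425] -/
def frakP (g q qs c d ds r : A) : A := 1 - g * qs * c * q - g * d * r * ds

/-- The formal G₁^{−1}-adjoint 𝔓* = I − Q*(QG₁Q*)^{−1}QG₁ − DRD*G₁ appearing in (3.153) (G₁, R, (QG₁Q*)^{−1}
symmetric). [cite: Balaban1985BackgroundPropagators, (3.153) p.426] -/
def frakPstar (g q qs c d ds r : A) : A := 1 - qs * c * q * g - d * r * ds * g

/-- **(3.146) ⇒ (3.147)** (p. 425 [PDF 37], kernel-checked): 𝔓A₀ = G̃₁(G₁^{−1} − DRD*)A₀ with G̃₁ = G₁ −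
G₁Q*(QG₁Q*)^{−1}QG₁ (3.143) expands to A₀ − G₁Q*(QG₁Q*)^{−1}QA₀ − G₁DRD*A₀ + G₁Q*(QG₁Q*)^{−1}QG₁DRD*A₀, and *"The
last term vanishes by the identities (3.129) [= (3.124) for G₁: QG₁DR = 0]"*.  Hypotheses: gi = G₁^{−1}
(g·gi = 1) and QG₁DR = 0. [cite: Balaban1985BackgroundPropagators, (3.146)–(3.147) p.425] -/
theorem frakP_of_3146 (g gi q qs c d ds r : A) (hg : g * gi = 1) (h124 : q * g * d * r = 0) :
    (g - g * qs * c * q * g) * (gi - d * r * ds) = frakP g q qs c d ds r := by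
  have e : (g - g * qs * c * q * g) * (gi - d * r * ds)
      = g * gi - g * d * r * ds - g * qs * c * q * (g * gi) + g * qs * c * (q * g * d * r) * ds := by
    noncomm_ring
  rw [e, hg, h124, frakP]
  noncomm_ring

/-- **p. 425, Q𝔓 = 0** (kernel-checked): from (QG₁Q*)(QG₁Q*)^{−1} = I and QG₁DR = 0 ((3.124) for G₁). [cite: Balaban1985BackgroundPropagators, p.425] -/
theorem q_mul_frakP (g q qs c d ds r : A) (hc : q * g * qs * c = 1) (h124 : q * g * d * r = 0) :
    q * frakP g q qs c d ds r = 0 := by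
  have e : q * frakP g q qs c d ds r = q - (q * g * qs * c) * q - (q * g * d * r) * ds := by
    rw [frakP]; noncomm_ring
  rw [e, hc, h124]; noncomm_ring

/-- **p. 425, RD*𝔓 = 0** (kernel-checked): from RD*G₁Q* = 0 ((3.124) for G₁) and RD*G₁DR = R (*"The last can
be proved by the same method as used in the proof of (3.124)"* — by-reference; algebraic certification in the
cell's GAPS C-B9-13: it follows from (3.152) and G′ΔR = R·). [cite: Balaban1985BackgroundPropagators, p.425] -/
theorem rds_mul_frakP (g q qs c d ds r : A) (h124 : r * ds * g * qs = 0) (hR : r * ds * g * d * r = r) :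
    r * ds * frakP g q qs c d ds r = 0 := by
  have e : r * ds * frakP g q qs c d ds r = r * ds - (r * ds * g * qs) * c * q - (r * ds * g * d * r) * ds := by
    rw [frakP]; noncomm_ring
  rw [e, h124, hR]; noncomm_ring

/-- **p. 425, 𝔓² = 𝔓** (kernel-checked) from Q𝔓 = 0 and RD*𝔓 = 0. [cite: Balaban1985BackgroundPropagators, p.425] -/
theorem frakP_idem (g q qs c d ds r : A) (hQ : q * frakP g q qs c d ds r = 0)
    (hRD : r * ds * frakP g q qs c d ds r = 0) :
    frakP g q qs c d ds r * frakP g q qs c d ds r = frakP g q qs c d ds r := by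
  have e : ∀ X : A, frakP g q qs c d ds r * X = X - g * qs * c * (q * X) - g * d * (r * ds * X) := by
    intro X; rw [frakP]; noncomm_ring
  rw [e, hQ, hRD]; noncomm_ring

/-- **(3.150), second equality** (p. 425 [PDF 37], kernel-checked): 𝔊 = (I − DG′RD*)G̃₁(I − DRG′D*) expands to
G₁ − DG′RD*G₁ − G₁DRG′D* + DG′RD*G₁DRG′D* − G₁Q*(QG₁Q*)^{−1}QG₁, the cross terms through G₁Q*(QG₁Q*)^{−1}QG₁
vanishing by (3.124) for G₁ (RD*G₁Q* = 0, QG₁DR = 0).  g' = G′. [cite: Balaban1985BackgroundPropagators, (3.150) p.425] -/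
theorem frakG_3150 (g g' q qs c d ds r : A) (h124a : r * ds * g * qs = 0) (h124b : q * g * d * r = 0) :
    (1 - d * g' * r * ds) * (g - g * qs * c * q * g) * (1 - d * r * g' * ds)
      = g - d * g' * r * ds * g - g * d * r * g' * ds + d * g' * r * ds * g * d * r * g' * ds
        - g * qs * c * q * g := by
  have e : (1 - d * g' * r * ds) * (g - g * qs * c * q * g) * (1 - d * r * g' * ds)
      = g - d * g' * r * ds * g - g * d * r * g' * ds + d * g' * r * ds * g * d * r * g' * ds
        - g * qs * c * q * g
        + d * g' * (r * ds * g * qs) * c * q * g + g * qs * c * (q * g * d * r) * g' * ds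
        - d * g' * (r * ds * g * qs) * c * (q * g * d * r) * g' * ds := by
    noncomm_ring
  rw [e, h124a, h124b]; noncomm_ring

/-- **(3.153)** (p. 426 [PDF 38], kernel-checked): with (3.152) RD*G₁ = RG′D*, G₁DR = DG′R and RG′D*DR = R (the
adjoint form of RD*G₁DR = R, p. 425) the expansion (3.150) collapses to 𝔊 = G₁ − G₁DRD*G₁ − G₁Q*(QG₁Q*)^{−1}QG₁
= G₁𝔓* = 𝔓G₁.  ((3.152) itself is the displayed Gaussian computation (3.151) + B6 (2.26)–(2.27): GAPS
C-B9-13 gives its algebraic certification.) [cite: Balaban1985BackgroundPropagators, (3.152)–(3.153) p.426] -/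
theorem frakG_3153 (g g' q qs c d ds r : A) (h152a : r * ds * g = r * g' * ds) (h152b : g * d * r = d * g' * r)
    (hR : r * g' * ds * d * r = r) :
    g - d * g' * r * ds * g - g * d * r * g' * ds + d * g' * r * ds * g * d * r * g' * ds - g * qs * c * q * g
      = g * frakPstar g q qs c d ds r ∧
    g * frakPstar g q qs c d ds r = frakP g q qs c d ds r * g := by
  have k3 : d * g' * r * ds * g * d * r * g' * ds = d * g' * r * g' * ds := by
    calc d * g' * r * ds * g * d * r * g' * ds = d * g' * (r * ds * g) * d * r * g' * ds := by noncomm_ring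
      _ = d * g' * (r * g' * ds) * d * r * g' * ds := by rw [h152a]
      _ = d * g' * (r * g' * ds * d * r) * g' * ds := by noncomm_ring
      _ = d * g' * r * g' * ds := by rw [hR]
  have k1 : d * g' * r * ds * g = d * g' * r * g' * ds := by
    calc d * g' * r * ds * g = d * g' * (r * ds * g) := by noncomm_ring
      _ = d * g' * (r * g' * ds) := by rw [h152a]
      _ = d * g' * r * g' * ds := by noncomm_ring
  have k2 : g * d * r * g' * ds = d * g' * r * g' * ds := by rw [h152b]
  have k4 : g * d * r * ds * g = d * g' * r * g' * ds := by
    rw [h152b]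
    calc d * g' * r * ds * g = d * g' * (r * ds * g) := by noncomm_ring
      _ = d * g' * (r * g' * ds) := by rw [h152a]
      _ = d * g' * r * g' * ds := by noncomm_ring
  constructor
  · rw [k3, k1, k2, frakPstar]
    have e : g * (1 - qs * c * q * g - d * r * ds * g) = g - g * qs * c * q * g - g * d * r * ds * g := by
      noncomm_ring
    rw [e, k4]; noncomm_ring
  · rw [frakPstar, frakP]; noncomm_ring

end SectDAlgebra

/-! ### Sect. D — the kernel bounds (3.132), (3.133); Theorems 3.12 and 3.13 separately -/

/-- The inequality **(3.132)** p. 422 [PDF 34] for a kernel on 𝔅 at one U with constants (C, δ₁) (verbatim):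
*"|(QGQ*)^{−1}(y, y′)| ≤ O(1)(L^jη)^{−2}(L^{j′}η)^{−d}e^{−δ₁d(y,y′)} for y ∈ Λ_j, y′ ∈ Λ_{j′}, (3.132) and the same for
the operator with G₁ instead of G"* (*"can be analyzed in the same way as the operator (Q′G′²Q′*)^{−1}. We will
not repeat these considerations here"* — GAPS G-B9-15, by analogy; δ₁ first appears here). [cite: Balaban1985BackgroundPropagators, (3.132) p.422] -/
def Ineq3132 (d : ℕ) (K : SiteKernel g B) (C δ₁ : ℝ) (U : B.Cfg) : Prop :=
  ∀ y y' : g.Site, |K.ker U y y'| ≤ C * (g.len y) ^ (-(2 : ℝ)) * (g.len y') ^ (-(d : ℝ)) *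
    Real.exp (-(δ₁ * g.dist y y'))

/-- The kernel of an H-operator (H = GQ*(QGQ*)^{−1} (3.126), H₁ (3.129)) seen through the three quantities of
(3.133): `e 0 U y y′` = sup_{x∈Δ(y)} |H_{μν}(x, y′)|, `e 1 U y y′` = sup_{x∈Δ(y)} |∇H_{μν}(x, y′)|, `h U β ζ y′` =
‖ζ∇H(·, y′)‖_β. [cite: Balaban1985BackgroundPropagators, (3.133) p.422] -/
structure HKernel (g : Geometry) (B : Backgrounds) where
  e : Fin 2 → B.Cfg → g.Site → g.Site → ℝ
  h : B.Cfg → ℝ → g.Cut → g.Site → ℝ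

/-- The inequalities **(3.133)** p. 422 [PDF 34] at one U with constants (C, C(β), δ₁) (verbatim): *"|H_{μν}(x, y′)|,
|∇H_{μν}(x, y′)|, ‖ζ∇H(·, y′)‖_β ≤ O(1)[1, (L^jη)^{−1}, (‖ζ‖^ξ_β + |ζ|)(L^jη)^{−1−β}](L^{j′}η)^{−d}e^{−(1/2)δ₁d(y,y′)},
for x ∈ Δ(y), or ζ ∈ C^∞₀(Δ̃(y)), y ∈ Λ_j, y′ ∈ Λ_{j′}. (3.133)  These inequalities are for the operator H given by
the formula (3.126). If we want to have H giving solutions of the variational problems (3.109), (3.110), then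
… we get (3.133) with an additional factor (L^jη)^{−1}, or (L^{j′}η)^{−1}, on the right-hand side."*  The cut-off
clause is typed with `cutInT ζ y` = ζ ∈ C₀^∞(Δ̃(y)) verbatim (revision v4, G-ref1-7). [cite: Balaban1985BackgroundPropagators, (3.133) p.422] -/
def Ineq3133 (d : ℕ) (H : HKernel g B) (C : ℝ) (Cβ : ℝ → ℝ) (δ₁ : ℝ) (U : B.Cfg) : Prop :=
  (∀ (n : Fin 2) (y y' : g.Site),
      H.e n U y y' ≤ C * (g.len y) ^ (-(n : ℝ)) * (g.len y') ^ (-(d : ℝ)) *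
        Real.exp (-(δ₁ / 2 * g.dist y y'))) ∧
  (∀ (β : ℝ) (ζ : g.Cut) (y y' : g.Site), 0 ≤ β → β < 1 → g.cutInT ζ y →
      H.h U β ζ y' ≤ Cβ β * g.cutH β ζ * (g.len y) ^ (-(1 + β)) * (g.len y') ^ (-(d : ℝ)) *
        Real.exp (-(δ₁ / 2 * g.dist y y')))

/-- Revision v4 ⟹ revision v3 for (3.133): the verbatim Hölder clause (ζ ∈ C₀^∞(Δ̃(y)), `cutInT`) implies the
clause for cut-offs supported in the small cube Δ(y) (`cutIn`). [cite: Balaban1985BackgroundPropagators, (3.133) p.422] -/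
theorem ineq3133_restrict (d : ℕ) (H : HKernel g B) (C : ℝ) (Cβ : ℝ → ℝ) (δ₁ : ℝ) (U : B.Cfg)
    (h : Ineq3133 d H C Cβ δ₁ U) :
    ∀ (β : ℝ) (ζ : g.Cut) (y y' : g.Site), 0 ≤ β → β < 1 → g.cutIn ζ y →
      H.h U β ζ y' ≤ Cβ β * g.cutH β ζ * (g.len y) ^ (-(1 + β)) * (g.len y') ^ (-(d : ℝ)) *
        Real.exp (-(δ₁ / 2 * g.dist y y')) :=
  fun β ζ y y' h0 h1 hζ => h.2 β ζ y y' h0 h1 (g.cutInT_of_cutIn ζ y hζ)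

/-- **Theorem 3.12** (p. 423 [PDF 35]) typed ALONE (verbatim): *"If an external gauge field configuration U
satisfies both regularity conditions (3.35), (3.36) for α₀ sufficiently small, then Theorems 3.3, 3.10, 3.11
hold for the propagators G, G₁, with one exception and the inequality (1.133)[sic: (3.133), G-B9-04] together
with Theorem 3.10 hold for the operators H, H₁. The exception is the inequality in (3.42) involving the covariant
Laplace operator. It does not hold for G, G₁."*  G = (Δ_π + DRD* + Q*aQ)^{−1} (3.122), G₁ (3.128) — Sect. D
operators (D-r1.2); "Theorem 3.3 holds" INCLUDES the Hölder entries (3.43)–(3.45) (sharper than the combined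
`Thm312_313Printed`, which drops them); Thm 3.10 ⇒ `HasRWExp`/`HasRWExpH` (tree-like walks, p. 427); Thm 3.11
⇒ `PosDefK`.  GAPS G-B9-16: the proof (3.130)–(3.138) is a perturbation series in Δ′_π, Δ^{(2)}_π with the one
displayed estimate (3.131) and one displayed Hölder pattern (p. 423); "M sufficiently large" is inherited. [cite: Balaban1985BackgroundPropagators, Thm 3.12 pp.421–423] -/
def Thm312Printed {I : Type} (d : ℕ) (c35 : ℝ) (geo : I → Geometry) (bg : I → Backgrounds)
    (GD G₁ : ∀ i, KernelFamily (geo i) (bg i)) (H H₁ : ∀ i, HKernel (geo i) (bg i))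
    (HasRWExp : ∀ i, KernelFamily (geo i) (bg i) → (bg i).Cfg → ℝ → Prop)
    (HasRWExpH : ∀ i, HKernel (geo i) (bg i) → (bg i).Cfg → ℝ → Prop)
    (PosDefK : ∀ i, KernelFamily (geo i) (bg i) → (bg i).Cfg → Prop) : Prop :=
  ∃ M₄ δ₀ a₀ B₀ : ℝ, ∃ Bβ Bε : ℝ → ℝ, ∃ Bεβ : ℝ → ℝ → ℝ, 0 < M₄ ∧ 0 < δ₀ ∧ 0 < a₀ ∧ 0 < B₀ ∧
    ∀ i : I, M₄ ≤ (geo i).M → ∀ α₀ : ℝ, 0 < α₀ → (geo i).M * α₀ ≤ a₀ →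
      ∀ U : (bg i).Cfg, (bg i).Reg335 c35 α₀ U → (bg i).Reg336 c35 α₀ U →
        (∀ K ∈ [GD i, G₁ i], Ineq342_346_347_noLap K B₀ δ₀ U ∧ Ineq343_345 K Bβ Bε Bεβ δ₀ U ∧
          HasRWExp i K U δ₀ ∧ PosDefK i K U) ∧
        (∀ Hk ∈ [H i, H₁ i], Ineq3133 d Hk B₀ Bβ δ₀ U ∧ HasRWExpH i Hk U δ₀)

/-- The CLAIM (3.132) for (QGQ*)^{−1} and (QG₁Q*)^{−1} as a family statement under the hypotheses of Theorem
3.12 (p. 422: stated in the running text before Thm 3.12; "assuming (3.132)" is how Thm 3.13 is introduced,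
p. 426). [cite: Balaban1985BackgroundPropagators, (3.132) p.422] -/
def Stmt3132Printed {I : Type} (d : ℕ) (c35 : ℝ) (geo : I → Geometry) (bg : I → Backgrounds)
    (QGQinv QG₁Qinv : ∀ i, SiteKernel (geo i) (bg i)) : Prop :=
  ∃ M₄ δ₁ a₀ C : ℝ, 0 < M₄ ∧ 0 < δ₁ ∧ 0 < a₀ ∧ 0 < C ∧
    ∀ i : I, M₄ ≤ (geo i).M → ∀ α₀ : ℝ, 0 < α₀ → (geo i).M * α₀ ≤ a₀ →
      ∀ U : (bg i).Cfg, (bg i).Reg335 c35 α₀ U → (bg i).Reg336 c35 α₀ U →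
        Ineq3132 d (QGQinv i) C δ₁ U ∧ Ineq3132 d (QG₁Qinv i) C δ₁ U

/-- **Theorem 3.13** (p. 426 [PDF 38]) typed ALONE (verbatim): *"If an external gauge field configuration U
satisfies the regularity conditions (3.35), (3.36) for α₀ sufficiently small, then Theorems 3.3, 3.10, 3.11 hold
for the propagator 𝔊, with the exception of the inequality in (3.42) involving the covariant Laplace operator."*
(𝔊 = 𝔓G₁ = G₁𝔓* (3.153), kernel-checked `frakG_3153`; introduced by *"Especially for 𝔊 we have, assuming
(3.132)"*.)  GAPS G-B9-11 (interface: no Δ_U𝔊 entry). [cite: Balaban1985BackgroundPropagators, Thm 3.13 p.426] -/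
def Thm313Printed {I : Type} (c35 : ℝ) (geo : I → Geometry) (bg : I → Backgrounds)
    (GG : ∀ i, KernelFamily (geo i) (bg i))
    (HasRWExp : ∀ i, KernelFamily (geo i) (bg i) → (bg i).Cfg → ℝ → Prop)
    (PosDefK : ∀ i, KernelFamily (geo i) (bg i) → (bg i).Cfg → Prop) : Prop :=
  ∃ M₄ δ₀ a₀ B₀ : ℝ, ∃ Bβ Bε : ℝ → ℝ, ∃ Bεβ : ℝ → ℝ → ℝ, 0 < M₄ ∧ 0 < δ₀ ∧ 0 < a₀ ∧ 0 < B₀ ∧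
    ∀ i : I, M₄ ≤ (geo i).M → ∀ α₀ : ℝ, 0 < α₀ → (geo i).M * α₀ ≤ a₀ →
      ∀ U : (bg i).Cfg, (bg i).Reg335 c35 α₀ U → (bg i).Reg336 c35 α₀ U →
        Ineq342_346_347_noLap (GG i) B₀ δ₀ U ∧ Ineq343_345 (GG i) Bβ Bε Bεβ δ₀ U ∧
          HasRWExp i (GG i) U δ₀ ∧ PosDefK i (GG i) U

/-- Bookkeeping (kernel-checked): the full Theorem 3.3 block implies its no-Laplacian form — the direction in
which Thms 3.12/3.13 weaken Thm 3.3 (interface warning G-B9-11 made checkable). [folklore] -/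
theorem noLap_of_full (K : KernelFamily g B) {B₀ δ₀ : ℝ} {U : B.Cfg} (h : Ineq342_346_347 K B₀ δ₀ U) :
    Ineq342_346_347_noLap K B₀ δ₀ U :=
  ⟨fun n lam y y' _ hl => h.1 n lam y y' hl, h.2.1, fun n lam γ _ hγ hγ' => h.2.2 n lam γ hγ hγ'⟩

/-! ### Sect. E — Theorem 3.15 in full -/

/-- **Theorem 3.15** (p. 432 [PDF 44]) — FULL statement (verbatim): *"For Mα₀ sufficiently small the propagator
C^{(k)}(Λ) is given by the formula (3.185), and satisfies the bound |C^{(k)}(Λ; y, y′)| ≤ B₀e^{−δ₀|y−y′|}, y, y′ ∈ Λ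
(3.187) with the constants B₀, δ₀ depending on d and L only. This propagator has a convergent random walk
expansion of the type described previously. Of course we have all the other consequences following from the
random walk expansion."*  ((3.185): C^{(k)}(Λ) = (I + D̄μ)QG̃₂Q*(I + μ*D̄*), (3.186): G̃₂ = G₂ − G₂Q̃*(Q̃G₂Q̃*)^{−1}Q̃G₂;
hypotheses (3.35)–(3.36); Λ ⊂ Λ_k a union of big blocks with dist(Λ, Λᶜ_k) > RM.)  `GivenBy3185 i U` = "C^{(k)}(Λ)
equals the right-hand side of (3.185)", `HasRWExpC i U δ₀` = the expansion clause — abstract, supplied by the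
user.  Extends r1's `Thm315Printed` (bound only; `thm315_bound_of_full`).  GAPS G-B9-09 (γ₀ for general U
asserted p. 428), G-B9-10 (OBJECTION: no estimate of the G₂ − G₁ terms of (3.183)–(3.184), p. 432),
G-B9-17 (the δ-function manipulations (3.159)–(3.182) are finite-dimensional and formal-but-checkable; (3.169)
explicit). [cite: Balaban1985BackgroundPropagators, Thm 3.15 (3.185)–(3.187) p.432] -/
def Thm315FullPrinted {I : Type} (c35 : ℝ) (geo : I → Geometry) (bg : I → Backgrounds)
    (Ck : ∀ i, SiteKernel (geo i) (bg i)) (inΛ : ∀ i, (geo i).Site → Prop)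
    (unitDist : ∀ i, (geo i).Site → (geo i).Site → ℝ)
    (GivenBy3185 : ∀ i, (bg i).Cfg → Prop) (HasRWExpC : ∀ i, (bg i).Cfg → ℝ → Prop) : Prop :=
  ∃ δ₀ a₀ B₀ : ℝ, 0 < δ₀ ∧ 0 < a₀ ∧ 0 < B₀ ∧
    ∀ i : I, ∀ α₀ : ℝ, 0 < α₀ → (geo i).M * α₀ ≤ a₀ →
      ∀ U : (bg i).Cfg, (bg i).Reg335 c35 α₀ U → (bg i).Reg336 c35 α₀ U →
        GivenBy3185 i U ∧ HasRWExpC i U δ₀ ∧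
        ∀ y y' : (geo i).Site, inΛ i y → inΛ i y' →
          |(Ck i).ker U y y'| ≤ B₀ * Real.exp (-(δ₀ * unitDist i y y'))

/-- Bookkeeping (kernel-checked): the full Theorem 3.15 contains r1's bound-only `Thm315Printed`. [folklore] -/
theorem thm315_bound_of_full {I : Type} (c35 : ℝ) (geo : I → Geometry) (bg : I → Backgrounds)
    (Ck : ∀ i, SiteKernel (geo i) (bg i)) (inΛ : ∀ i, (geo i).Site → Prop)
    (unitDist : ∀ i, (geo i).Site → (geo i).Site → ℝ)
    (GivenBy3185 : ∀ i, (bg i).Cfg → Prop) (HasRWExpC : ∀ i, (bg i).Cfg → ℝ → Prop)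
    (h : Thm315FullPrinted c35 geo bg Ck inΛ unitDist GivenBy3185 HasRWExpC) :
    Thm315Printed c35 geo bg Ck inΛ unitDist := by
  obtain ⟨δ₀, a₀, B₀, hδ, ha, hB, H⟩ := h
  exact ⟨δ₀, a₀, B₀, hδ, ha, hB, fun i α₀ hα hMa U hU hU' => (H i α₀ hα hMa U hU hU').2.2⟩

/-! ### The paper's proof architecture in one kernel-checked statement -/

/-- **The logical architecture of B9, kernel-checked** (C-B9-6 made formal): from the induction base U = 1
(`BaseU1Printed`, = B6), the Sect. B step (`SectBStepPrinted`), the gauge reduction (`GaugeReduction335`), the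
Sect. C expansions (Thms 3.7, 3.9, 3.10 as typed) and the Sect. C summation leaves, ALL of Theorems 3.1, 3.2,
3.3, 3.4 and Corollaries 3.5, 3.6 follow as typed — i.e. the paper's Sects. A–C contain no circularity: the
only inputs not proved in B9 are the named leaves (each a GAPS row).  (Sect. C's use of Cor. 3.6 for the local
operators G′_□, C_□, G_□ is INSIDE the leaves `Thm37Printed`/`Thm39Printed`/`Thm310Printed` as hypotheses of
their printed proofs, p. 409; it is recorded, not re-derived.) [cite: Balaban1985BackgroundPropagators, Sects. A–C pp.397–416] -/
theorem sectsAC_architecture {I : Type} (d : ℕ) (c35 : ℝ) (hc : 0 < c35) (geo : I → Geometry)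
    (bg : I → Backgrounds) (InCube : I → Prop) (Gp GA : ∀ i, KernelFamily (geo i) (bg i))
    (Cinv : ∀ i, SiteKernel (geo i) (bg i))
    (IsAnalyticExt : ∀ i, KernelFamily (geo i) (bg i) → (bg i).Cfg → ℝ → Prop)
    (E7 E10 : ∀ i, RWExpansion (geo i) (bg i)) (E9 : ∀ i, RWKernelExpansion (geo i) (bg i))
    (hone : ∀ i : I, ∀ α₀ : ℝ, 0 < α₀ → (bg i).Reg335 c35 α₀ (bg i).one)
    (hbase : BaseU1Printed d geo bg Gp GA Cinv)
    (hB : SectBStepPrinted d c35 geo bg Gp GA Cinv IsAnalyticExt)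
    (hg : GaugeReduction335 d c35 geo bg InCube Gp GA Cinv)
    (h37 : Thm37Printed c35 geo bg E7) (h39 : Thm39Printed d c35 geo bg E9) (h310 : Thm310Printed c35 geo bg E10)
    (hsum : RWSumsYieldIneqs geo bg E7 E10 Gp GA) (hksum : RWKernelSumYields d geo bg E9 Cinv) :
    Cor35Printed d geo bg Gp GA Cinv ∧ Cor36Printed d c35 geo bg InCube Gp GA Cinv ∧
    Thm31Printed c35 geo bg Gp ∧ Thm32Printed d c35 geo bg Cinv ∧ Thm33Printed c35 geo bg Gp GA ∧
    Thm34Printed c35 geo bg Gp GA IsAnalyticExt := by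
  have h35 := cor35_of_sectB_base d c35 geo bg Gp GA Cinv IsAnalyticExt hone hbase hB
  have h36 := cor36_of_cor35 d c35 hc geo bg InCube Gp GA Cinv h35 hg
  have h31 := thm31_of_thm37 c35 geo bg E7 E10 Gp GA h37 hsum
  have h32 := thm32_of_thm39 d c35 geo bg E9 Cinv h39 hksum
  have h33 := thm33_of_thm37_310 c35 geo bg E7 E10 Gp GA h37 h310 hsum
  exact ⟨h35, h36, h31, h32, h33, thm34_of_sectB d c35 geo bg Gp GA Cinv IsAnalyticExt hB h32 h33⟩


/-! ## Phase 2b (cell b09) — Theorem 3.14: the exponential bookkeeping of the printed sketch (p. 427)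

p. 427 [PDF 39]: *"This theorem can be proved in exactly the same way as the corresponding property in the
theorem of [2]. We take random walk expansions for both operators, and in the difference all terms for walks
with localizations contained in Ω are cancelled. Remaining terms correspond to walks of the general type
(3.107), for which at least one localization X_i intersects Ωᶜ. Then the exponential factor in (3.108) gives
the factor (3.154) (after adjusting a definition of δ₀)."*  The last sentence made quantitative: the walk
distance d(ω, y, y′) of (3.93) is an infimum of chains through points y_i of the localizations; if the chain
passes through a point z of a localization X_i of d-diameter ≤ r which meets Ωᶜ in y₁, then
d(y, y′, Ω) ≤ |y − y₁| + |y₁ − y′| ≤ d(ω, y, y′) + 2r (`dOmega_le_walk_add`, triangle inequality), hence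
e^{−δd(ω,y,y′)} ≤ e^{δr}·e^{−½δd(ω,y,y′)}·e^{−½δd(y,y′,Ω)} (`thm314_factor_split`): the factor (3.154) appears
with half the rate and a LOSS e^{δ₀r}, r = O(M) = the d-diameter of a localization cube of the walk — absorbed
without loss only for walks with d(ω, y, y′) ≥ 2r (`thm314_factor_split_far`); for the short walks near ∂Ω the
printed "(after adjusting a definition of δ₀)" has to carry an M-dependence (of the rate, of the constant, or
of d(y, y′, Ω) shifted by O(M)) that is not spelled out.  GAPS G-B9-08 (r1: proof by reference + the
cancellation requires the local factors of the two sequences to coincide inside Ω), G-B9-19 (b09: this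
bookkeeping).
-/

/-- Triangle-inequality step of Thm 3.14's sketch: if the walk's chain passes through z, z lies in a
localization of diameter ≤ r meeting Ωᶜ at y₁ (|z − y₁| ≤ r), then the two-leg distance through y₁ — an upper
bound for d(y, y′, Ω) of (3.154) — is at most the chain length plus 2r. [folklore] -/
theorem dOmega_le_walk_add {X : Type*} [PseudoMetricSpace X] (y y' z y₁ : X) {r dω : ℝ}
    (hz : dist z y₁ ≤ r) (hω : dist y z + dist z y' ≤ dω) :
    dist y y₁ + dist y₁ y' ≤ dω + 2 * r := by
  have h1 : dist y y₁ ≤ dist y z + dist z y₁ := dist_triangle y z y₁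
  have h2 : dist y₁ y' ≤ dist y₁ z + dist z y' := dist_triangle y₁ z y'
  have h3 : dist y₁ z = dist z y₁ := dist_comm y₁ z
  linarith

/-- The exponential bookkeeping of *"the exponential factor in (3.108) gives the factor (3.154) (after
adjusting a definition of δ₀)"* (p. 427): from d(y, y′, Ω) ≤ d(ω, y, y′) + 2r and δ ≥ 0,
e^{−δd(ω,y,y′)} ≤ e^{δr} e^{−½δd(ω,y,y′)} e^{−½δd(y,y′,Ω)} — half the rate survives for the summation over
walks, the factor (3.154) appears with rate ½δ, and the price is the constant e^{δr}. [folklore] -/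
theorem thm314_factor_split {δ r dω dΩ : ℝ} (hδ : 0 ≤ δ) (h : dΩ ≤ dω + 2 * r) :
    Real.exp (-(δ * dω)) ≤
      Real.exp (δ * r) * Real.exp (-(δ / 2 * dω)) * Real.exp (-(δ / 2 * dΩ)) := by
  rw [← Real.exp_add, ← Real.exp_add]
  apply Real.exp_le_exp.mpr
  have h2 : δ / 2 * dΩ ≤ δ / 2 * (dω + 2 * r) := mul_le_mul_of_nonneg_left h (by linarith)
  linarith

/-- Loss-free version for long walks: if moreover d(ω, y, y′) ≥ 2r then d(y, y′, Ω) ≤ 2d(ω, y, y′) and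
e^{−δd(ω,y,y′)} ≤ e^{−½δd(ω,y,y′)} e^{−¼δd(y,y′,Ω)} with no constant. [folklore] -/
theorem thm314_factor_split_far {δ r dω dΩ : ℝ} (hδ : 0 ≤ δ) (h : dΩ ≤ dω + 2 * r) (hfar : 2 * r ≤ dω) :
    Real.exp (-(δ * dω)) ≤ Real.exp (-(δ / 2 * dω)) * Real.exp (-(δ / 4 * dΩ)) := by
  rw [← Real.exp_add]
  apply Real.exp_le_exp.mpr
  have h1 : dΩ ≤ 2 * dω := by linarith
  have h2 : δ / 4 * dΩ ≤ δ / 4 * (2 * dω) := mul_le_mul_of_nonneg_left h1 (by linarith)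
  linarith

end Literature.MathematicalPhysics.QuantumFieldTheory.Balaban1983to89.B9
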